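import Literature.AlgebraicGeometry.Milne1999.HodgeGroupProductsPowers
import Literature.AlgebraicGeometry.Milne1999.LefschetzGroupFamilyStructure
import HarnessLib

/-!
# `L(B^{m+1} × C^{n+1}) = L(B × C)` and `ker l(B^{m+1} × C^{n+1}) = ker l(B × C)` acting block-diagonally, for ARBITRARY factors and with the character: transfer of Lefschetz-group membership along intertwining retractions (Milne 1999, §1 p. 643, Def. 4.3, Prop. 1.5, Cor. 4.7; Moonen–Zarhin 1999, §1 — Tannaka-free, on the family carriers)

Family `hodge`, layer `Literature/AlgebraicGeometry/Milne1999`, namespace `Literature.AlgebraicGeometry.Milne1999` (D-0022).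
THEOREMS ONLY (no definition, no named fact, no `sorry`; net debt 0). The `L` / `ker l` companion of
`Milne1999/HodgeGroupProductsSplitting` §1 (transfer of `Hg`-membership along an intertwining retraction),
`Milne1999/HodgeGroupPowersDiagonal` §5 (`Hg(A^{r+1}) = Hg(A)` diagonally) and `Milne1999/HodgeGroupProductsPowers` §2
(`Hg(B^{m+1} × C^{n+1}) = Hg(B × C)` block-diagonally), written by the `lit-hodgefound` prover seat p21 (generation 35, row #4) to close
what those files list under "What is NOT here" («the analogous statements for Milne's `S` […] (same mechanism)») and what the
seat's `LefschetzGroupProductsRestriction` / `LefschetzGroupTorusFiniteProducts` need `Hom(X, Y) = 0` and `dim ≥ 1` for: the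
Lefschetz group WITH ITS CHARACTER of a product of unequal powers of two ARBITRARY complex abelian varieties.

## Sources, verbatim (held texts re-opened for this file)

* J. S. Milne, *Lefschetz classes on abelian varieties*, Duke Math. J. 96 (1999) [held: `paper:doi-10-1215-s0012-7094-99-09620-5`,
  p0005 L12–L16, p0006 L24–L28, p0021 L42–L44 / p0022 L5–L13]: §1 p. 643 «For any positive integer `r`, `V(A^r) = rV(A)`, and the
  diagonal action of `C(A)` on `rV(A)` identifies `C(A)` with `C(A^r)` (as `k`-algebras with involution). Let `A = A_1 × ⋯ × A_s`.
  Then `C(A) ⊂ C(A_1) × ⋯ × C(A_s)`, with equality holding if and only if `Hom(A_i, A_j) = 0` for all `i, j`, `i ≠ j`.»;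
  Prop. 1.5 «Any such isogeny induces an isomorphism `S(A_1) × ⋯ × S(A_s) → S(A)`»; Def. 4.3 (p. 659) «The Lefschetz group `L(A)` of an
  abelian variety `A` over `Ω` is the largest algebraic subgroup of `GL(V(A)) × 𝔾_m/k` fixing the elements of `D^s_hom(A^r)_k ⊂ H^{2s}(A^r)(s)`
  for all `r, s`»; Cor. 4.7 «An isogeny `A → A_1^{r_1} × ⋯ × A_s^{r_s}` with the `A_i` simple and pairwise nonisogenous defines an
  isomorphism `(L(A), l(A)) → ∏ (L(A_i), l(A_i))` […] Because two of the vertical maps are isomorphisms, so also is the third.»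
* B. Moonen, Yu. G. Zarhin, *Hodge classes on abelian varieties of low dimension*, Math. Ann. 315 (1999) [held:
  `paper:arxiv-math_9901113`, chunk p0002 L137–L141], §1: «For `n ≥ 1` we can identify `Hg(Xⁿ)` with `Hg(X)`, acting diagonally on
  `V_{Xⁿ} = (V_X)ⁿ`. More generally, if `n_1, …, n_r ∈ ℤ_{≥1}` then we can identify `Hg(X_1^{n_1} × ⋯ × X_r^{n_r})` with `Hg(X_1 × ⋯ × X_r)`.»

## The objects (all pre-existing in the tree; nothing is defined here)

`L(Y)(ℂ) = lefschetzGroup (dim Y) Y.X` and `ker l(Y)(ℂ) = specialLefschetzGroup (dim Y) Y.X` (`Milne1999/LefschetzGroup`): the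
families `g = (g_k)_k ∈ ∏ₖ GL(Hᵏ(Y(ℂ); ℂ))` admitting a Künneth extension to the powers `Y.X^{×(a+1)}` that acts on every Lefschetz class
of degree `2p` of every power by `cᵖ` for one `c ∈ ℂˣ` (resp. fixes them); `lefschetzPowClasses`/`divisorClassesSpan` = the `ℂ`-span of
the `p`-fold cup products of rational `(1,1)`-classes; for an abelian variety every such `g` is `⋀•(g₁)`
(`lefschetzGroup_eq_exteriorPullbackEquiv`) and its Künneth family is `⋀•(g₁^{⊕(a+1)})`
(`kunnethFamily_eq_exteriorKunnethFamily_of_mem_lefschetzGroup`; `exteriorKunnethFamily = castAut ∘ diagPowExterior`). On `H¹` of a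
product `s ⊕ t = prodBlockDiagEquiv s t`, on a power `u^{⊕(r+1)} = diagPow A u r`, `⋀•(u^{⊕(r+1)}) = diagPowExterior A u r`,
`Y^{r+1} = Y.powSucc r`, the weight cocharacter `w(c) = weightCocharacter Y.X c` (`c^k` on `Hᵏ`). THE CHARACTER `l` is carried, as in the
seat's previous files, CLASS-FREE by the pair («`g ∈ ker l`», «`w(c) ↦ w(c)`»): an isomorphism of Lefschetz groups matching the
kernels of `l` and the weight cocharacters matches `l` (`l ∘ w = 2`, `L = w(𝔾_m) · ker l`).

## What is proved

* §1 **`L` AND `ker l` ACT THROUGH `H¹` ON ALL POWERS — READ-OUTS AND MEMBERSHIP CRITERIA** (Def. 4.3 on the carriers):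
  `diagPowExterior_apply_eq_self_of_mem_specialLefschetzGroup` (for `g ∈ ker l(A)`, `⋀•(g₁^{⊕(a+1)})` fixes `Dᵖ(A^{a+1}) ⊗ ℂ`),
  `exists_forall_diagPowExterior_apply_eq_smul_of_mem_lefschetzGroup` (for `g ∈ L(A)` it acts there by `cᵖ`, one `c`), and conversely
  `exteriorPullbackEquiv_mem_specialLefschetzGroup_of_forall`, `exteriorPullbackEquiv_mem_lefschetzGroup_of_forall`; `iff` forms.
* §2 **TRANSFER ALONG INTERTWINING RETRACTIONS** (the one mechanism): if `⋀•u_P ∈ ker l(P)` (resp. `∈ L(P)`) and every power `Q^{a+1}`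
  is a retract `Q^{a+1} ⇄ P^{M+1}` by homomorphisms whose retraction intertwines `u_P^{⊕(M+1)}` with `u_Q^{⊕(a+1)}` on `H¹`, then
  `⋀•u_Q ∈ ker l(Q)` (resp. `∈ L(Q)`, with THE SAME scalar `c`): a Lefschetz class of `Q^{a+1}` pulls back to a Lefschetz class of `P^{M+1}`
  (`map_mem_divisorClassesSpan`: divisor classes pull back to divisor classes and pull-back is a ring map), `⋀•` is functorial along
  intertwining homomorphisms (`exteriorPullback_map_of_intertwine`) and a retraction is injective on cohomology
  (`exteriorPullbackEquiv_mem_specialLefschetzGroup_of_forall_exists_retraction`, `…_lefschetzGroup_…`; the plain retraction case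
  `…_of_retraction`, `M = a`, via the lane's `exists_retraction_powSucc_of_intertwine`).
* §3 **`L(A^{r+1}) = L(A)` AND `ker l(A^{r+1}) = ker l(A)` DIAGONALLY, NO DIMENSION HYPOTHESIS** («the diagonal action of `C(A)` on
  `rV(A)` identifies `C(A)` with `C(A^r)`», Prop. 1.5 / Cor. 4.7 for a power): `diagPowExterior_mem_(special)lefschetzGroup_powSucc`,
  `exists_of_mem_(special)lefschetzGroup_powSucc`, `mem_(special)lefschetzGroup_powSucc_iff_exists_diagPowExterior` (the tree's
  `LefschetzGroupOnePowers` has the `H¹` statements under `dim A ≥ 1`, through Thm. 4.4; here by retractions, for every `A`).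
* §4 **`L(B^{m+1} × C^{n+1}) = L(B × C)` AND `ker l(B^{m+1} × C^{n+1}) = ker l(B × C)`, BLOCK-DIAGONALLY, FOR ARBITRARY `B`, `C`**
  (Moonen–Zarhin §1 second sentence, `r = 2`, for Milne's groups; Milne §1 p. 643 + Def. 4.3): a family `g'` lies in
  `L(B^{m+1} × C^{n+1})(ℂ)` iff `g' = ⋀•(u^{⊕(m+1)} ⊕ v^{⊕(n+1)})` with `⋀•(u ⊕ v) ∈ L(B × C)(ℂ)`
  (`mem_lefschetzGroup_powSucc_prod_powSucc_iff`, `mem_specialLefschetzGroup_powSucc_prod_powSucc_iff`, their two halves, and the `H¹`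
  forms `prodBlockDiagEquiv_diagPow_mem_map_(special)lefschetzGroup_one_iff`); also the hypothesis-free factor read-out
  `exists_eq_prodBlockDiagEquiv_of_mem_(special)lefschetzGroup_prod` («`C(A) ⊂ C(A_1) × ⋯ × C(A_s)`»: every element of `L(B × C)` is
  `⋀•(u ⊕ v)` with `⋀•u ∈ L(B)`, `⋀•v ∈ L(C)`; the tree's `exists_eq_prodBlockDiagEquiv_of_mem_map_lefschetzGroup_one_prod` needs
  `dim ≥ 1`). NO hypothesis on `(B, C)`: `Hom(B, C)` arbitrary, any dimensions.
* §5 **`(L(B × C), l) ≅ (L(B^{m+1} × C^{n+1}), l)` AS GROUPS WITH CHARACTER** (`exists_lefschetzGroup_prod_mulEquiv_powSucc_prod_powSucc`):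
  an explicit `e : L(B × C)(ℂ) ≃* L(B^{m+1} × C^{n+1})(ℂ)` with `(e g)₁ = u^{⊕(m+1)} ⊕ v^{⊕(n+1)}` when `g₁ = u ⊕ v`,
  `e g ∈ ker l ⟺ g ∈ ker l`, `e(w(c)) = w(c)`; hence `ker l(B × C)(ℂ) ≃* ker l(B^{m+1} × C^{n+1})(ℂ)`
  (`exists_specialLefschetzGroup_prod_mulEquiv_powSucc_prod_powSucc`) and torus coordinates with character pass from `B × C` to
  `B^{m+1} × C^{n+1}` (`exists_lefschetzGroup_powSucc_prod_powSucc_mulEquiv_of_mulEquiv`, the format of the seat's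
  `LefschetzGroupTorusFiniteProducts`).

## What is NOT here (honest column)

Three or more factors with unequal exponents (iterate §4/§5 along `(X × Y) × Z`); the image of `L(B × C)` in `L(B) × L(C)` when
`Hom(B, C) ≠ 0` (only the REDUCTION of all exponents to `1` is proved — the group `L(B × C)` itself is not computed); Milne's
algebraic groups / the Tannakian `(L, l)` (Def. 4.6 fibre products) beyond the class-free pair (`ker l`, `w`); the analogous statements
for André's `G¹_mot` and the absolute Hodge stabiliser (same mechanism; `Summits/…/Ring2HypothesesDescentAbsoluteExteriorStabilizerProductsPowers`,
not importable into Literature, proves the `ker l` half of §4 inside the summit's namespace by a generic stabiliser argument — this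
file is the Literature-side statement with `L` and the character). PRESEARCH (2026-08-28): corpus `paper:doi-10-1215-s0012-7094-99-09620-5`
pp. 643–644, 659–660 and `paper:arxiv-math_9901113` §1 re-read (quotes above); tree: `rg 'powSucc_prod_powSucc'` finds the `Hg` version
(`HodgeGroupProductsPowers`), the `Hom`-orthogonal `H¹` version `mem_map_lefschetzGroup_one_powSucc_prod_powSucc_iff`
(`LefschetzGroupOneIsogenyFactors`, needs `Hom(B, C) = 0 = Hom(C, B)` and polarization data) and the summit-side `ker l` version; no
Literature statement for `L` with arbitrary `Hom(B, C)`; certification on the carriers, no novelty claimed.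

## References

* [Milne1999LefschetzClasses] J. S. Milne, Lefschetz classes on abelian varieties, Duke Math. J. 96 (1999) 639–675: §1 p. 643,
  Prop. 1.5 (p. 644), Def. 4.3 and p. 659 (`l`, `w`, `ker l = S`), Cor. 4.7 (p. 660).
* [MoonenZarhin1999LowDim] B. Moonen, Yu. G. Zarhin, Hodge classes on abelian varieties of low dimension, Math. Ann. 315 (1999)
  711–733: §1.
* [LangeBirkenhake1992] H. Lange, Ch. Birkenhake, Complex Abelian Varieties (1992): Lemma 1.1.17, Thm. 4.2.1.
* [HatcherAT2002] A. Hatcher, Algebraic Topology (2002): §3.2 Thm. 3.16, Prop. 3.10.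
* [vanGeemen1994HodgeAV] B. van Geemen, An introduction to the Hodge conjecture for abelian varieties, LNM 1594 (1994): §2.4.
-/

noncomputable section

open CategoryTheory MonoidalCategory CartesianMonoidalCategory
open Literature.AlgebraicTopology.SingularHomology
open Literature.AlgebraicGeometry.HodgeTheory
open Literature.AlgebraicGeometry.Motives
open Literature.Barriers.HodgeConjecture (divisorClassesSpan)

namespace Literature.AlgebraicGeometry.Milne1999

/-! ### §0 Plumbing (generic objects, private): products and composites of retractions, blockwise intertwining, `L|_{H¹} ≤ C` -/

section Plumbing

/-- A product of retractions is a retraction (generic objects). [folklore] -/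
private theorem retraction_prod {X X' Y Y' : AbelianVariety ℂ} {ι : X ⟶ X'} {π : X' ⟶ X} (h : ι ≫ π = 𝟙 X) {ι₀ : Y ⟶ Y'}
    {π₀ : Y' ⟶ Y} (h₀ : ι₀ ≫ π₀ = 𝟙 Y) :
    AbelianVariety.prodLift (AbelianVariety.fst X Y ≫ ι) (AbelianVariety.snd X Y ≫ ι₀) ≫
        AbelianVariety.prodLift (AbelianVariety.fst X' Y' ≫ π) (AbelianVariety.snd X' Y' ≫ π₀) = 𝟙 (X.prod Y) := by
  refine AbelianVariety.prod_hom_ext ?_ ?_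
  · rw [Category.assoc, AbelianVariety.prodLift_fst, ← Category.assoc, AbelianVariety.prodLift_fst, Category.assoc, h,
      Category.id_comp, Category.comp_id]
  · rw [Category.assoc, AbelianVariety.prodLift_snd, ← Category.assoc, AbelianVariety.prodLift_snd, Category.assoc, h₀,
      Category.id_comp, Category.comp_id]

/-- A product `π × π₀` of homomorphisms intertwining `H¹`-automorphisms blockwise intertwines the block sums (generic objects).
[cite: Milne1999LefschetzClasses, §1 p. 643] [cite: HatcherAT2002, §3.2 Thm. 3.16] -/
private theorem intertwine_prod {X X' Y Y' : AbelianVariety ℂ} (π : X' ⟶ X) (π₀ : Y' ⟶ Y)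
    (UX' : complexBetti X'.X 1 ≃ₗ[ℂ] complexBetti X'.X 1) (UX : complexBetti X.X 1 ≃ₗ[ℂ] complexBetti X.X 1)
    (UY' : complexBetti Y'.X 1 ≃ₗ[ℂ] complexBetti Y'.X 1) (UY : complexBetti Y.X 1 ≃ₗ[ℂ] complexBetti Y.X 1)
    (hX : ∀ q : complexBetti X.X 1, UX' (complexBetti.map π.hom.hom.hom 1 q) = complexBetti.map π.hom.hom.hom 1 (UX q))
    (hY : ∀ z : complexBetti Y.X 1, UY' (complexBetti.map π₀.hom.hom.hom 1 z) = complexBetti.map π₀.hom.hom.hom 1 (UY z))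
    (y : complexBetti (X.prod Y).X 1) :
    prodBlockDiagEquiv UX' UY' (complexBetti.map
        (AbelianVariety.prodLift (AbelianVariety.fst X' Y' ≫ π) (AbelianVariety.snd X' Y' ≫ π₀)).hom.hom.hom 1 y) =
      complexBetti.map (AbelianVariety.prodLift (AbelianVariety.fst X' Y' ≫ π) (AbelianVariety.snd X' Y' ≫ π₀)).hom.hom.hom 1
        (prodBlockDiagEquiv UX UY y) :=
  apply_map_eq_map_prodBlockDiagEquiv _ _ _ _
    (fun q ↦ by rw [AbelianVariety.prodLift_fst, complexBetti_map_comp_apply, complexBetti_map_comp_apply,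
      prodBlockDiagEquiv_apply_map_fst, hX])
    (fun z ↦ by rw [AbelianVariety.prodLift_snd, complexBetti_map_comp_apply, complexBetti_map_comp_apply,
      prodBlockDiagEquiv_apply_map_snd, hY]) y

/-- Retractions compose (generic objects). [folklore] -/
private theorem retraction_comp {X Y Z : AbelianVariety ℂ} {ι : X ⟶ Y} {π : Y ⟶ X} (h : ι ≫ π = 𝟙 X) {ι' : Y ⟶ Z} {π' : Z ⟶ Y}
    (h' : ι' ≫ π' = 𝟙 Y) : (ι ≫ ι') ≫ (π' ≫ π) = 𝟙 X := by
  rw [Category.assoc, ← Category.assoc ι', h', Category.id_comp, h]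

/-- `s ⊕ t` determines `s` and `t`. [cite: Milne1999LefschetzClasses, §1 p. 643 (V(A₁ × A₂) = V(A₁) ⊕ V(A₂))] -/
private theorem prodBlockDiagEquiv_inj {X Y : AbelianVariety ℂ} {s s' : complexBetti X.X 1 ≃ₗ[ℂ] complexBetti X.X 1}
    {t t' : complexBetti Y.X 1 ≃ₗ[ℂ] complexBetti Y.X 1} (h : prodBlockDiagEquiv s t = prodBlockDiagEquiv s' t') :
    s = s' ∧ t = t' := by
  have e := congrArg LinearEquiv.toLinearMap h
  rw [coe_prodBlockDiagEquiv, coe_prodBlockDiagEquiv] at e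
  refine ⟨LinearEquiv.toLinearMap_injective ?_, LinearEquiv.toLinearMap_injective ?_⟩
  · rw [← prodRestrictFst_prodBlockDiag s.toLinearMap t.toLinearMap, e, prodRestrictFst_prodBlockDiag]
  · rw [← prodRestrictSnd_prodBlockDiag s.toLinearMap t.toLinearMap, e, prodRestrictSnd_prodBlockDiag]

/-- `L(A)(ℂ)|_{H¹} ≤ (C(A) ⊗ ℂ)^×`: `g₁` commutes with every `φ^*`, `φ ∈ End(A)`, for `g ∈ L(A)(ℂ)` (`L = w(𝔾_m) · ker l`, the
scalars are central, `ker l|_{H¹} ≤ C` — the tree's `specialLefschetzGroup_map_one_le_centralizerGroup`; restated privately to keep the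
imports of this file inside the `HodgeGroupProductsPowers` cone). [cite: Milne1999LefschetzClasses, Thm. 4.4 and p. 659 (L = w·ker l)] -/
private theorem apply_one_mem_centralizerGroup_of_mem_lefschetzGroup {A : AbelianVariety ℂ}
    {g : ∀ k : ℕ, complexBetti A.X k ≃ₗ[ℂ] complexBetti A.X k} (hg : g ∈ lefschetzGroup A.dim A.X) :
    g 1 ∈ centralizerGroup A := by
  obtain ⟨c, s, hs, rfl⟩ := mem_lefschetzGroup_iff_exists_weightCocharacter_mul.1 hg
  rw [weightCocharacter_mul_apply_one]
  refine mul_mem (fun φ x ↦ ?_) (specialLefschetzGroup_map_one_le_centralizerGroup A ⟨s, hs, rfl⟩)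
  simp [LinearEquiv.smulOfUnit, Units.smul_def, map_smul]

/-- `w(c)₁ = c` on `H¹`. [cite: Milne1999LefschetzClasses, p. 659 (the cocharacter w)] -/
private theorem weightCocharacter_one_eq_smulOfUnit (Z : AbelianVariety ℂ) (c : ℂˣ) :
    weightCocharacter Z.X c 1 = LinearEquiv.smulOfUnit c := by
  rw [show weightCocharacter Z.X c 1 = LinearEquiv.smulOfUnit (c ^ 1) from rfl, pow_one]

/-- `g ∈ ker l(Z)` iff `g₁ ∈ ker l(Z)|_{H¹}`, for `g ∈ L(Z)` (an element of `L` is determined by its `H¹`-component).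
[cite: Milne1999LefschetzClasses, Def. 4.3 and Thm. 4.4 (p. 659)] -/
private theorem mem_specialLefschetzGroup_iff_apply_one_mem {Z : AbelianVariety ℂ} {g : ∀ k : ℕ, complexBetti Z.X k ≃ₗ[ℂ] complexBetti Z.X k}
    (hg : g ∈ lefschetzGroup Z.dim Z.X) :
    g ∈ specialLefschetzGroup Z.dim Z.X ↔
      g 1 ∈ (specialLefschetzGroup Z.dim Z.X).map
        (Pi.evalMonoidHom (fun k : ℕ ↦ complexBetti Z.X k ≃ₗ[ℂ] complexBetti Z.X k) 1) := by
  refine ⟨fun h ↦ ⟨g, h, rfl⟩, ?_⟩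
  rintro ⟨s, hs, hs1⟩
  have e : s = g := lefschetzGroup_ext_one' (specialLefschetzGroup_le_lefschetzGroup hs) hg hs1
  exact e ▸ hs

/-- Transport, cartesian power → abelian variety, of «fixes the divisor spans» along `Y = Y'`, `N = N'` (by `subst`). [folklore] -/
private theorem apply_eq_self_of_castAut {Y Y' : Motives.SchemeOver ℂ} (e : Y = Y') {N N' : ℕ} (hN : N = N')
    (G : ∀ k : ℕ, complexBetti Y k ≃ₗ[ℂ] complexBetti Y k)
    (h : ∀ (p : ℕ), ∀ x ∈ divisorClassesSpan Y' N' p, castAut e G (2 * p) x = x)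
    (p : ℕ) (c : complexBetti Y (2 * p)) (hc : c ∈ divisorClassesSpan Y N p) : G (2 * p) c = c := by
  subst e hN
  exact h p c hc

/-- Transport, abelian variety → cartesian power, of «fixes the divisor spans» (by `subst`). [folklore] -/
private theorem castAut_apply_eq_self_of {Y Y' : Motives.SchemeOver ℂ} (e : Y = Y') {N N' : ℕ} (hN : N = N')
    (G : ∀ k : ℕ, complexBetti Y k ≃ₗ[ℂ] complexBetti Y k)
    (h : ∀ (p : ℕ), ∀ c ∈ divisorClassesSpan Y N p, G (2 * p) c = c)
    (p : ℕ) (x : complexBetti Y' (2 * p)) (hx : x ∈ divisorClassesSpan Y' N' p) : castAut e G (2 * p) x = x := by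
  subst e hN
  exact h p x hx

/-- Transport, cartesian power → abelian variety, of «acts on `Dᵖ ⊗ ℂ` by `cᵖ`» (by `subst`). [folklore] -/
private theorem apply_eq_smul_of_castAut {Y Y' : Motives.SchemeOver ℂ} (e : Y = Y') {N N' : ℕ} (hN : N = N')
    (G : ∀ k : ℕ, complexBetti Y k ≃ₗ[ℂ] complexBetti Y k) (t : ℂ)
    (h : ∀ (p : ℕ), ∀ x ∈ divisorClassesSpan Y' N' p, castAut e G (2 * p) x = (t ^ p) • x)
    (p : ℕ) (c : complexBetti Y (2 * p)) (hc : c ∈ divisorClassesSpan Y N p) : G (2 * p) c = (t ^ p) • c := by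
  subst e hN
  exact h p c hc

/-- Transport, abelian variety → cartesian power, of «acts on `Dᵖ ⊗ ℂ` by `cᵖ`» (by `subst`). [folklore] -/
private theorem castAut_apply_eq_smul_of {Y Y' : Motives.SchemeOver ℂ} (e : Y = Y') {N N' : ℕ} (hN : N = N')
    (G : ∀ k : ℕ, complexBetti Y k ≃ₗ[ℂ] complexBetti Y k) (t : ℂ)
    (h : ∀ (p : ℕ), ∀ c ∈ divisorClassesSpan Y N p, G (2 * p) c = (t ^ p) • c)
    (p : ℕ) (x : complexBetti Y' (2 * p)) (hx : x ∈ divisorClassesSpan Y' N' p) : castAut e G (2 * p) x = (t ^ p) • x := by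
  subst e hN
  exact h p x hx

end Plumbing

/-! ### §1 `L` and `ker l` act through `H¹` on all powers: read-outs and membership criteria (Def. 4.3 on the carriers) -/

section Criteria

variable {A : AbelianVariety ℂ} {g : ∀ k : ℕ, complexBetti A.X k ≃ₗ[ℂ] complexBetti A.X k}
  {u : complexBetti A.X 1 ≃ₗ[ℂ] complexBetti A.X 1}

/-- **For `g ∈ ker l(A)(ℂ)`, `⋀•(g₁^{⊕(a+1)})` fixes every Lefschetz class `Dᵖ(A^{a+1}) ⊗ ℂ` of the abelian variety `A^{a+1}`** (its Künneth
family, read on `(A^{a+1}).X = A.X^{×(a+1)}`). [cite: Milne1999LefschetzClasses, Def. 4.3 and p. 659 (kernel of l(A))] -/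
theorem diagPowExterior_apply_eq_self_of_mem_specialLefschetzGroup (hg : g ∈ specialLefschetzGroup A.dim A.X) (a p : ℕ)
    {c : complexBetti (A.powSucc a).X (2 * p)} (hc : c ∈ divisorClassesSpan (A.powSucc a).X (A.powSucc a).dim p) :
    diagPowExterior A (g 1) a (2 * p) c = c := by
  obtain ⟨G, hG, h0, hfix⟩ := hg
  have hGeq : G = exteriorKunnethFamily A (g 1) :=
    kunnethFamily_eq_exteriorKunnethFamily_of_mem_specialLefschetzGroup ⟨G, hG, h0, hfix⟩ hG h0
  refine apply_eq_self_of_castAut (A.powSucc_X_eq_cartesianPow a) (A.dim_powSucc_eq_cartesianPowDim a) (diagPowExterior A (g 1) a)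
    (fun q x hx ↦ ?_) p c hc
  have e := hfix a q x ((mem_lefschetzPowClasses_iff a q x).2 hx)
  rwa [hGeq] at e

/-- **For `g ∈ L(A)(ℂ)`, `⋀•(g₁^{⊕(a+1)})` acts on `Dᵖ(A^{a+1}) ⊗ ℂ` by `cᵖ` for ONE `c ∈ ℂˣ` (all `a`, `p`)** — the `𝔾_m`-component of `g`.
[cite: Milne1999LefschetzClasses, Def. 4.3 (p. 659)] -/
theorem exists_forall_diagPowExterior_apply_eq_smul_of_mem_lefschetzGroup (hg : g ∈ lefschetzGroup A.dim A.X) :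
    ∃ c : ℂˣ, ∀ (a p : ℕ) (x : complexBetti (A.powSucc a).X (2 * p)),
      x ∈ divisorClassesSpan (A.powSucc a).X (A.powSucc a).dim p → diagPowExterior A (g 1) a (2 * p) x = ((c : ℂ) ^ p) • x := by
  obtain ⟨G, hG, h0, c, hfix⟩ := hg
  have hGeq : G = exteriorKunnethFamily A (g 1) :=
    kunnethFamily_eq_exteriorKunnethFamily_of_mem_lefschetzGroup ⟨G, hG, h0, c, hfix⟩ hG h0
  refine ⟨c, fun a p x hx ↦ apply_eq_smul_of_castAut (A.powSucc_X_eq_cartesianPow a) (A.dim_powSucc_eq_cartesianPowDim a)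
    (diagPowExterior A (g 1) a) (c : ℂ) (fun q y hy ↦ ?_) p x hx⟩
  have e := hfix a q y ((mem_lefschetzPowClasses_iff a q y).2 hy)
  rwa [hGeq] at e

/-- **Conversely, for `ker l`**: if `⋀•(u^{⊕(a+1)})` fixes `Dᵖ(A^{a+1}) ⊗ ℂ` for all `a`, `p`, then `(⋀ᵏu)_k ∈ ker l(A)(ℂ)` (its Künneth
family is `⋀•(u^{⊕(a+1)})`, `isKunnethFamily_exteriorKunnethFamily`). [cite: Milne1999LefschetzClasses, Def. 4.3 and p. 659] -/
theorem exteriorPullbackEquiv_mem_specialLefschetzGroup_of_forall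
    (h : ∀ (a p : ℕ) (c : complexBetti (A.powSucc a).X (2 * p)), c ∈ divisorClassesSpan (A.powSucc a).X (A.powSucc a).dim p →
      diagPowExterior A u a (2 * p) c = c) :
    (fun k ↦ exteriorPullbackEquiv (AbelianVariety.hasExteriorCohomologyH1_complexPoints A) u k) ∈ specialLefschetzGroup A.dim A.X :=
  ⟨exteriorKunnethFamily A u, isKunnethFamily_exteriorKunnethFamily A u, exteriorKunnethFamily_zero A u,
    fun a p x hx ↦ castAut_apply_eq_self_of (A.powSucc_X_eq_cartesianPow a) (A.dim_powSucc_eq_cartesianPowDim a)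
      (diagPowExterior A u a) (h a) p x hx⟩

/-- **Conversely, for `L`**: if `⋀•(u^{⊕(a+1)})` acts on `Dᵖ(A^{a+1}) ⊗ ℂ` by `cᵖ` for all `a`, `p` (one `c ∈ ℂˣ`), then `(⋀ᵏu)_k ∈ L(A)(ℂ)`.
[cite: Milne1999LefschetzClasses, Def. 4.3 (p. 659)] -/
theorem exteriorPullbackEquiv_mem_lefschetzGroup_of_forall (c : ℂˣ)
    (h : ∀ (a p : ℕ) (x : complexBetti (A.powSucc a).X (2 * p)), x ∈ divisorClassesSpan (A.powSucc a).X (A.powSucc a).dim p →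
      diagPowExterior A u a (2 * p) x = ((c : ℂ) ^ p) • x) :
    (fun k ↦ exteriorPullbackEquiv (AbelianVariety.hasExteriorCohomologyH1_complexPoints A) u k) ∈ lefschetzGroup A.dim A.X :=
  ⟨exteriorKunnethFamily A u, isKunnethFamily_exteriorKunnethFamily A u, exteriorKunnethFamily_zero A u, c,
    fun a p x hx ↦ castAut_apply_eq_smul_of (A.powSucc_X_eq_cartesianPow a) (A.dim_powSucc_eq_cartesianPowDim a)
      (diagPowExterior A u a) (c : ℂ) (h a) p x hx⟩

/-- **`(⋀ᵏu)_k ∈ ker l(A)(ℂ)` iff `⋀•(u^{⊕(a+1)})` fixes `Dᵖ(A^{a+1}) ⊗ ℂ` for all `a`, `p`** — Def. 4.3 / «the kernel of `l(A)`» read on the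
abelian varieties `A^{a+1}`. [cite: Milne1999LefschetzClasses, Def. 4.3 and p. 659] -/
theorem exteriorPullbackEquiv_mem_specialLefschetzGroup_iff_forall :
    (fun k ↦ exteriorPullbackEquiv (AbelianVariety.hasExteriorCohomologyH1_complexPoints A) u k) ∈ specialLefschetzGroup A.dim A.X ↔
      ∀ (a p : ℕ) (c : complexBetti (A.powSucc a).X (2 * p)), c ∈ divisorClassesSpan (A.powSucc a).X (A.powSucc a).dim p →
        diagPowExterior A u a (2 * p) c = c := by
  refine ⟨fun hu a p c hc ↦ ?_, exteriorPullbackEquiv_mem_specialLefschetzGroup_of_forall⟩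
  have e := diagPowExterior_apply_eq_self_of_mem_specialLefschetzGroup hu a p hc
  rwa [exteriorPullbackEquiv_one_eq] at e

/-- **`(⋀ᵏu)_k ∈ L(A)(ℂ)` iff for one `c ∈ ℂˣ`, `⋀•(u^{⊕(a+1)})` acts on `Dᵖ(A^{a+1}) ⊗ ℂ` by `cᵖ` for all `a`, `p`.**
[cite: Milne1999LefschetzClasses, Def. 4.3 (p. 659)] -/
theorem exteriorPullbackEquiv_mem_lefschetzGroup_iff_exists_forall :
    (fun k ↦ exteriorPullbackEquiv (AbelianVariety.hasExteriorCohomologyH1_complexPoints A) u k) ∈ lefschetzGroup A.dim A.X ↔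
      ∃ c : ℂˣ, ∀ (a p : ℕ) (x : complexBetti (A.powSucc a).X (2 * p)),
        x ∈ divisorClassesSpan (A.powSucc a).X (A.powSucc a).dim p → diagPowExterior A u a (2 * p) x = ((c : ℂ) ^ p) • x := by
  refine ⟨fun hu ↦ ?_, fun ⟨c, h⟩ ↦ exteriorPullbackEquiv_mem_lefschetzGroup_of_forall c h⟩
  obtain ⟨c, hc⟩ := exists_forall_diagPowExterior_apply_eq_smul_of_mem_lefschetzGroup hu
  rw [exteriorPullbackEquiv_one_eq] at hc
  exact ⟨c, hc⟩

end Criteria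

/-! ### §2 Transfer of membership along intertwining retractions of the powers -/

section Transfer

variable {P Q : AbelianVariety ℂ} {uP : complexBetti P.X 1 ≃ₗ[ℂ] complexBetti P.X 1} {uQ : complexBetti Q.X 1 ≃ₗ[ℂ] complexBetti Q.X 1}

/-- **Pointwise transfer, fixed classes.** For a section–retraction pair `ι : Q^{a+1} → P^{M+1}`, `π : P^{M+1} → Q^{a+1}` (`ι ≫ π = 𝟙`) with
`u_P^{⊕(M+1)} ∘ π^* = π^* ∘ u_Q^{⊕(a+1)}` on `H¹`: if `⋀ᵏ(u_P^{⊕(M+1)})` fixes `π^* c` then `⋀ᵏ(u_Q^{⊕(a+1)})` fixes `c` (`⋀•` is functorial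
along intertwining homomorphisms, and `ι^* π^* = 1`). [cite: Milne1999LefschetzClasses, §1 p. 643] [cite: HatcherAT2002, §3.2 Thm. 3.16] -/
theorem diagPowExterior_apply_eq_self_of_retraction {M a : ℕ} {ι : Q.powSucc a ⟶ P.powSucc M} {π : P.powSucc M ⟶ Q.powSucc a}
    (hιπ : ι ≫ π = 𝟙 _)
    (hint : ∀ y : complexBetti (Q.powSucc a).X 1,
      diagPow P uP M (complexBetti.map π.hom.hom.hom 1 y) = complexBetti.map π.hom.hom.hom 1 (diagPow Q uQ a y))
    {k : ℕ} {c : complexBetti (Q.powSucc a).X k}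
    (h : diagPowExterior P uP M k (complexBetti.map π.hom.hom.hom k c) = complexBetti.map π.hom.hom.hom k c) :
    diagPowExterior Q uQ a k c = c := by
  rw [diagPowExterior, exteriorPullbackEquiv_apply,
    exteriorPullback_map_of_intertwine π (diagPow P uP M).toLinearMap (diagPow Q uQ a).toLinearMap (fun y ↦ hint y)] at h
  have e := congrArg (complexBetti.map ι.hom.hom.hom k) h
  rwa [map_map_of_comp_eq_id hιπ, map_map_of_comp_eq_id hιπ, ← exteriorPullbackEquiv_apply] at e

/-- **Pointwise transfer, scaled classes**: same, with «acts by the scalar `t`» in place of «fixes».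
[cite: Milne1999LefschetzClasses, §1 p. 643 and Def. 4.3] [cite: HatcherAT2002, §3.2 Thm. 3.16] -/
theorem diagPowExterior_apply_eq_smul_of_retraction {M a : ℕ} {ι : Q.powSucc a ⟶ P.powSucc M} {π : P.powSucc M ⟶ Q.powSucc a}
    (hιπ : ι ≫ π = 𝟙 _)
    (hint : ∀ y : complexBetti (Q.powSucc a).X 1,
      diagPow P uP M (complexBetti.map π.hom.hom.hom 1 y) = complexBetti.map π.hom.hom.hom 1 (diagPow Q uQ a y))
    {k : ℕ} {t : ℂ} {c : complexBetti (Q.powSucc a).X k}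
    (h : diagPowExterior P uP M k (complexBetti.map π.hom.hom.hom k c) = t • complexBetti.map π.hom.hom.hom k c) :
    diagPowExterior Q uQ a k c = t • c := by
  rw [diagPowExterior, exteriorPullbackEquiv_apply,
    exteriorPullback_map_of_intertwine π (diagPow P uP M).toLinearMap (diagPow Q uQ a).toLinearMap (fun y ↦ hint y), ← map_smul] at h
  have e := congrArg (complexBetti.map ι.hom.hom.hom k) h
  rwa [map_map_of_comp_eq_id hιπ, map_map_of_comp_eq_id hιπ, ← exteriorPullbackEquiv_apply] at e

/-- **Transfer of `ker l`-membership along intertwining retractions of the powers.** If `⋀•u_P ∈ ker l(P)(ℂ)` and every `Q^{a+1}` is a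
retract `Q^{a+1} ⇄ P^{M+1}` (homomorphisms of abelian varieties) whose retraction intertwines `u_P^{⊕(M+1)}` with `u_Q^{⊕(a+1)}` on `H¹`, then
`⋀•u_Q ∈ ker l(Q)(ℂ)`: a Lefschetz class of `Q^{a+1}` pulls back to a Lefschetz class of `P^{M+1}` (`map_mem_divisorClassesSpan`), fixed by
the Künneth family of `⋀•u_P` (§1), and comes back (§2 pointwise). [cite: Milne1999LefschetzClasses, §1 p. 643, Def. 4.3 and p. 659]
[cite: vanGeemen1994HodgeAV, §2.4 (pull-back of divisor classes)] -/
theorem exteriorPullbackEquiv_mem_specialLefschetzGroup_of_forall_exists_retraction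
    (hP : (fun k ↦ exteriorPullbackEquiv (AbelianVariety.hasExteriorCohomologyH1_complexPoints P) uP k) ∈ specialLefschetzGroup P.dim P.X)
    (h : ∀ a : ℕ, ∃ (M : ℕ) (ι : Q.powSucc a ⟶ P.powSucc M) (π : P.powSucc M ⟶ Q.powSucc a), ι ≫ π = 𝟙 _ ∧
      ∀ y : complexBetti (Q.powSucc a).X 1,
        diagPow P uP M (complexBetti.map π.hom.hom.hom 1 y) = complexBetti.map π.hom.hom.hom 1 (diagPow Q uQ a y)) :
    (fun k ↦ exteriorPullbackEquiv (AbelianVariety.hasExteriorCohomologyH1_complexPoints Q) uQ k) ∈ specialLefschetzGroup Q.dim Q.X := by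
  refine exteriorPullbackEquiv_mem_specialLefschetzGroup_of_forall fun a p c hc ↦ ?_
  obtain ⟨M, ι, π, hιπ, hint⟩ := h a
  have hfix := diagPowExterior_apply_eq_self_of_mem_specialLefschetzGroup hP M p
    (map_mem_divisorClassesSpan (AbelianVariety.isSmoothProjective_holds (A := P.powSucc M))
      (AbelianVariety.isSmoothProjective_holds (A := Q.powSucc a)) π.hom.hom.hom hc)
  rw [exteriorPullbackEquiv_one_eq] at hfix
  exact diagPowExterior_apply_eq_self_of_retraction hιπ hint hfix

/-- **Transfer of the scalar system**: if `⋀•(u_P^{⊕(M+1)})` acts on `Dᵖ(P^{M+1}) ⊗ ℂ` by `cᵖ` for all `M`, `p`, and the powers of `Q`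
are intertwined retracts as above, then `⋀•(u_Q^{⊕(a+1)})` acts on `Dᵖ(Q^{a+1}) ⊗ ℂ` by THE SAME `cᵖ`.
[cite: Milne1999LefschetzClasses, §1 p. 643 and Def. 4.3 (p. 659)] -/
theorem forall_diagPowExterior_apply_eq_smul_of_forall_exists_retraction (c : ℂˣ)
    (hP : ∀ (M p : ℕ) (x : complexBetti (P.powSucc M).X (2 * p)), x ∈ divisorClassesSpan (P.powSucc M).X (P.powSucc M).dim p →
      diagPowExterior P uP M (2 * p) x = ((c : ℂ) ^ p) • x)
    (h : ∀ a : ℕ, ∃ (M : ℕ) (ι : Q.powSucc a ⟶ P.powSucc M) (π : P.powSucc M ⟶ Q.powSucc a), ι ≫ π = 𝟙 _ ∧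
      ∀ y : complexBetti (Q.powSucc a).X 1,
        diagPow P uP M (complexBetti.map π.hom.hom.hom 1 y) = complexBetti.map π.hom.hom.hom 1 (diagPow Q uQ a y))
    (a p : ℕ) (x : complexBetti (Q.powSucc a).X (2 * p)) (hx : x ∈ divisorClassesSpan (Q.powSucc a).X (Q.powSucc a).dim p) :
    diagPowExterior Q uQ a (2 * p) x = ((c : ℂ) ^ p) • x := by
  obtain ⟨M, ι, π, hιπ, hint⟩ := h a
  exact diagPowExterior_apply_eq_smul_of_retraction hιπ hint (hP M p _
    (map_mem_divisorClassesSpan (AbelianVariety.isSmoothProjective_holds (A := P.powSucc M))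
      (AbelianVariety.isSmoothProjective_holds (A := Q.powSucc a)) π.hom.hom.hom hx))

/-- **Transfer of `L`-membership along intertwining retractions of the powers** (the `𝔾_m`-component is preserved).
[cite: Milne1999LefschetzClasses, §1 p. 643 and Def. 4.3 (p. 659)] -/
theorem exteriorPullbackEquiv_mem_lefschetzGroup_of_forall_exists_retraction
    (hP : (fun k ↦ exteriorPullbackEquiv (AbelianVariety.hasExteriorCohomologyH1_complexPoints P) uP k) ∈ lefschetzGroup P.dim P.X)
    (h : ∀ a : ℕ, ∃ (M : ℕ) (ι : Q.powSucc a ⟶ P.powSucc M) (π : P.powSucc M ⟶ Q.powSucc a), ι ≫ π = 𝟙 _ ∧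
      ∀ y : complexBetti (Q.powSucc a).X 1,
        diagPow P uP M (complexBetti.map π.hom.hom.hom 1 y) = complexBetti.map π.hom.hom.hom 1 (diagPow Q uQ a y)) :
    (fun k ↦ exteriorPullbackEquiv (AbelianVariety.hasExteriorCohomologyH1_complexPoints Q) uQ k) ∈ lefschetzGroup Q.dim Q.X := by
  obtain ⟨c, hc⟩ := exists_forall_diagPowExterior_apply_eq_smul_of_mem_lefschetzGroup hP
  rw [exteriorPullbackEquiv_one_eq] at hc
  exact exteriorPullbackEquiv_mem_lefschetzGroup_of_forall c
    (forall_diagPowExterior_apply_eq_smul_of_forall_exists_retraction c hc h)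

/-- **Transfer of `ker l`-membership along an intertwining retraction** `ι : Q → P`, `π : P → Q`, `ι ≫ π = 𝟙`, `u_P ∘ π^* = π^* ∘ u_Q` on
`H¹`: `⋀•u_P ∈ ker l(P)(ℂ) ⟹ ⋀•u_Q ∈ ker l(Q)(ℂ)` (the induced retractions `Q^{a+1} ⇄ P^{a+1}` intertwine the diagonals,
`exists_retraction_powSucc_of_intertwine`). The `ker l` analogue of `exteriorPullbackEquiv_mem_hodgeGroup_of_retraction`.
[cite: Milne1999LefschetzClasses, §1 p. 643, Prop. 1.5 and p. 659] -/
theorem exteriorPullbackEquiv_mem_specialLefschetzGroup_of_retraction (ι : Q ⟶ P) (π : P ⟶ Q) (hιπ : ι ≫ π = 𝟙 Q)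
    (h : ∀ y : complexBetti Q.X 1, uP (complexBetti.map π.hom.hom.hom 1 y) = complexBetti.map π.hom.hom.hom 1 (uQ y))
    (hP : (fun k ↦ exteriorPullbackEquiv (AbelianVariety.hasExteriorCohomologyH1_complexPoints P) uP k) ∈ specialLefschetzGroup P.dim P.X) :
    (fun k ↦ exteriorPullbackEquiv (AbelianVariety.hasExteriorCohomologyH1_complexPoints Q) uQ k) ∈ specialLefschetzGroup Q.dim Q.X :=
  exteriorPullbackEquiv_mem_specialLefschetzGroup_of_forall_exists_retraction hP fun a ↦
    ⟨a, exists_retraction_powSucc_of_intertwine ι π hιπ uP uQ h a⟩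

/-- **Transfer of `L`-membership along an intertwining retraction**: `⋀•u_P ∈ L(P)(ℂ) ⟹ ⋀•u_Q ∈ L(Q)(ℂ)`.
[cite: Milne1999LefschetzClasses, §1 p. 643 and Def. 4.3 (p. 659)] -/
theorem exteriorPullbackEquiv_mem_lefschetzGroup_of_retraction (ι : Q ⟶ P) (π : P ⟶ Q) (hιπ : ι ≫ π = 𝟙 Q)
    (h : ∀ y : complexBetti Q.X 1, uP (complexBetti.map π.hom.hom.hom 1 y) = complexBetti.map π.hom.hom.hom 1 (uQ y))
    (hP : (fun k ↦ exteriorPullbackEquiv (AbelianVariety.hasExteriorCohomologyH1_complexPoints P) uP k) ∈ lefschetzGroup P.dim P.X) :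
    (fun k ↦ exteriorPullbackEquiv (AbelianVariety.hasExteriorCohomologyH1_complexPoints Q) uQ k) ∈ lefschetzGroup Q.dim Q.X :=
  exteriorPullbackEquiv_mem_lefschetzGroup_of_forall_exists_retraction hP fun a ↦
    ⟨a, exists_retraction_powSucc_of_intertwine ι π hιπ uP uQ h a⟩

end Transfer

/-! ### §3 `L(A^{r+1}) = L(A)` and `ker l(A^{r+1}) = ker l(A)` diagonally, with no dimension hypothesis -/

section Powers

variable (A : AbelianVariety ℂ) (r : ℕ)

/-- **`⊇` for `ker l`: if `⋀•u ∈ ker l(A)(ℂ)` then `⋀•(u^{⊕(r+1)}) ∈ ker l(A^{r+1})(ℂ)`** — every `(A^{r+1})^{a+1}` is a retract of some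
`A^{N+1}`, all homomorphisms between powers intertwining the diagonals of `u ∈ C(A) ⊗ ℂ` («the diagonal action of `C(A)` on `rV(A)`
identifies `C(A)` with `C(A^r)`»). [cite: Milne1999LefschetzClasses, §1 p. 643 and Prop. 1.5] [cite: MoonenZarhin1999LowDim, §1] -/
theorem diagPowExterior_mem_specialLefschetzGroup_powSucc {u : complexBetti A.X 1 ≃ₗ[ℂ] complexBetti A.X 1}
    (hu : (fun k ↦ exteriorPullbackEquiv (AbelianVariety.hasExteriorCohomologyH1_complexPoints A) u k) ∈ specialLefschetzGroup A.dim A.X) :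
    diagPowExterior A u r ∈ specialLefschetzGroup (A.powSucc r).dim (A.powSucc r).X := by
  have hC : u ∈ centralizerGroup A :=
    specialLefschetzGroup_map_one_le_centralizerGroup A ⟨_, hu, exteriorPullbackEquiv_one_eq _ _⟩
  exact exteriorPullbackEquiv_mem_specialLefschetzGroup_of_forall_exists_retraction hu fun a ↦ by
    obtain ⟨N, ι, π, hιπ⟩ := exists_retraction_powSucc_powSucc_powSucc A r a
    exact ⟨N, ι, π, hιπ, fun y ↦ diagPow_map_powSucc_powSucc hC r N a π y⟩

/-- **`⊇` for `L`: if `⋀•u ∈ L(A)(ℂ)` then `⋀•(u^{⊕(r+1)}) ∈ L(A^{r+1})(ℂ)`.** [cite: Milne1999LefschetzClasses, §1 p. 643, Def. 4.3 and Cor. 4.7]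
[cite: MoonenZarhin1999LowDim, §1] -/
theorem diagPowExterior_mem_lefschetzGroup_powSucc {u : complexBetti A.X 1 ≃ₗ[ℂ] complexBetti A.X 1}
    (hu : (fun k ↦ exteriorPullbackEquiv (AbelianVariety.hasExteriorCohomologyH1_complexPoints A) u k) ∈ lefschetzGroup A.dim A.X) :
    diagPowExterior A u r ∈ lefschetzGroup (A.powSucc r).dim (A.powSucc r).X := by
  have hC : u ∈ centralizerGroup A := by
    have e := apply_one_mem_centralizerGroup_of_mem_lefschetzGroup hu
    rwa [exteriorPullbackEquiv_one_eq] at e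
  exact exteriorPullbackEquiv_mem_lefschetzGroup_of_forall_exists_retraction hu fun a ↦ by
    obtain ⟨N, ι, π, hιπ⟩ := exists_retraction_powSucc_powSucc_powSucc A r a
    exact ⟨N, ι, π, hιπ, fun y ↦ diagPow_map_powSucc_powSucc hC r N a π y⟩

/-- **`⊆` for `ker l`: every element of `ker l(A^{r+1})(ℂ)` is `⋀•(u^{⊕(r+1)})` with `⋀•u ∈ ker l(A)(ℂ)`** — `g'₁ ∈ C(A^{r+1}) = C(A)^{diag}`
(`exists_eq_diagPow_of_mem_centralizerGroup`), and `A^{a+1}` is a retract of `(A^{r+1})^{a+1}`.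
[cite: Milne1999LefschetzClasses, §1 p. 643 and Prop. 1.5] [cite: MoonenZarhin1999LowDim, §1] -/
theorem exists_of_mem_specialLefschetzGroup_powSucc
    {g' : ∀ k : ℕ, complexBetti (A.powSucc r).X k ≃ₗ[ℂ] complexBetti (A.powSucc r).X k}
    (hg' : g' ∈ specialLefschetzGroup (A.powSucc r).dim (A.powSucc r).X) :
    ∃ u : complexBetti A.X 1 ≃ₗ[ℂ] complexBetti A.X 1,
      (fun k ↦ exteriorPullbackEquiv (AbelianVariety.hasExteriorCohomologyH1_complexPoints A) u k) ∈ specialLefschetzGroup A.dim A.X ∧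
        g' = diagPowExterior A u r := by
  have h1 : g' 1 ∈ centralizerGroup (A.powSucc r) := specialLefschetzGroup_map_one_le_centralizerGroup _ ⟨g', hg', rfl⟩
  obtain ⟨u, hu, huU⟩ := exists_eq_diagPow_of_mem_centralizerGroup r (g' 1) h1
  have hg'eq : g' = fun k ↦ exteriorPullbackEquiv (AbelianVariety.hasExteriorCohomologyH1_complexPoints (A.powSucc r)) (diagPow A u r) k := by
    rw [specialLefschetzGroup_eq_exteriorPullbackEquiv hg', ← huU]
  refine ⟨u, ?_, hg'eq⟩
  refine exteriorPullbackEquiv_mem_specialLefschetzGroup_of_forall_exists_retraction (P := A.powSucc r) (uP := diagPow A u r)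
    (hg'eq ▸ hg') fun a ↦ ?_
  obtain ⟨ι, π, hιπ⟩ := exists_retraction_powSucc_powSucc A r a
  exact ⟨a, ι, π, hιπ, fun y ↦ diagPow_powSucc_map_powSucc hu r a a π y⟩

/-- **`⊆` for `L`: every element of `L(A^{r+1})(ℂ)` is `⋀•(u^{⊕(r+1)})` with `⋀•u ∈ L(A)(ℂ)`.**
[cite: Milne1999LefschetzClasses, §1 p. 643, Def. 4.3 and Cor. 4.7] [cite: MoonenZarhin1999LowDim, §1] -/
theorem exists_of_mem_lefschetzGroup_powSucc
    {g' : ∀ k : ℕ, complexBetti (A.powSucc r).X k ≃ₗ[ℂ] complexBetti (A.powSucc r).X k}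
    (hg' : g' ∈ lefschetzGroup (A.powSucc r).dim (A.powSucc r).X) :
    ∃ u : complexBetti A.X 1 ≃ₗ[ℂ] complexBetti A.X 1,
      (fun k ↦ exteriorPullbackEquiv (AbelianVariety.hasExteriorCohomologyH1_complexPoints A) u k) ∈ lefschetzGroup A.dim A.X ∧
        g' = diagPowExterior A u r := by
  have h1 : g' 1 ∈ centralizerGroup (A.powSucc r) := apply_one_mem_centralizerGroup_of_mem_lefschetzGroup hg'
  obtain ⟨u, hu, huU⟩ := exists_eq_diagPow_of_mem_centralizerGroup r (g' 1) h1
  have hg'eq : g' = fun k ↦ exteriorPullbackEquiv (AbelianVariety.hasExteriorCohomologyH1_complexPoints (A.powSucc r)) (diagPow A u r) k := by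
    rw [lefschetzGroup_eq_exteriorPullbackEquiv hg', ← huU]
  refine ⟨u, ?_, hg'eq⟩
  refine exteriorPullbackEquiv_mem_lefschetzGroup_of_forall_exists_retraction (P := A.powSucc r) (uP := diagPow A u r)
    (hg'eq ▸ hg') fun a ↦ ?_
  obtain ⟨ι, π, hιπ⟩ := exists_retraction_powSucc_powSucc A r a
  exact ⟨a, ι, π, hιπ, fun y ↦ diagPow_powSucc_map_powSucc hu r a a π y⟩

/-- **`ker l(A^{r+1})(ℂ) = ker l(A)(ℂ)` ACTING DIAGONALLY, every `A`** (Prop. 1.5 «`S(A^r) = S(A)`» on the family carriers): a family `g'`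
of automorphisms of the `Hᵏ(A^{r+1}(ℂ); ℂ)` lies in `ker l(A^{r+1})` iff `g' = ⋀•(u^{⊕(r+1)})` with `⋀•u ∈ ker l(A)`.
[cite: Milne1999LefschetzClasses, Prop. 1.5 (p. 644) and p. 659] [cite: MoonenZarhin1999LowDim, §1] -/
theorem mem_specialLefschetzGroup_powSucc_iff_exists_diagPowExterior
    (g' : ∀ k : ℕ, complexBetti (A.powSucc r).X k ≃ₗ[ℂ] complexBetti (A.powSucc r).X k) :
    g' ∈ specialLefschetzGroup (A.powSucc r).dim (A.powSucc r).X ↔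
      ∃ u : complexBetti A.X 1 ≃ₗ[ℂ] complexBetti A.X 1,
        (fun k ↦ exteriorPullbackEquiv (AbelianVariety.hasExteriorCohomologyH1_complexPoints A) u k) ∈ specialLefschetzGroup A.dim A.X ∧
          g' = diagPowExterior A u r :=
  ⟨exists_of_mem_specialLefschetzGroup_powSucc A r, fun ⟨_, hu, e⟩ ↦ e ▸ diagPowExterior_mem_specialLefschetzGroup_powSucc A r hu⟩

/-- **`L(A^{r+1})(ℂ) = L(A)(ℂ)` ACTING DIAGONALLY, every `A`** (Cor. 4.7 for a power, on the family carriers).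
[cite: Milne1999LefschetzClasses, §1 p. 643 and Cor. 4.7 (p. 660)] [cite: MoonenZarhin1999LowDim, §1] -/
theorem mem_lefschetzGroup_powSucc_iff_exists_diagPowExterior
    (g' : ∀ k : ℕ, complexBetti (A.powSucc r).X k ≃ₗ[ℂ] complexBetti (A.powSucc r).X k) :
    g' ∈ lefschetzGroup (A.powSucc r).dim (A.powSucc r).X ↔
      ∃ u : complexBetti A.X 1 ≃ₗ[ℂ] complexBetti A.X 1,
        (fun k ↦ exteriorPullbackEquiv (AbelianVariety.hasExteriorCohomologyH1_complexPoints A) u k) ∈ lefschetzGroup A.dim A.X ∧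
          g' = diagPowExterior A u r :=
  ⟨exists_of_mem_lefschetzGroup_powSucc A r, fun ⟨_, hu, e⟩ ↦ e ▸ diagPowExterior_mem_lefschetzGroup_powSucc A r hu⟩

end Powers

/-! ### §4 `L(B^{m+1} × C^{n+1}) = L(B × C)` and `ker l(B^{m+1} × C^{n+1}) = ker l(B × C)` block-diagonally, for arbitrary `B`, `C` -/

section Products

variable (B C : AbelianVariety ℂ)

/-- **`ker l(B × C) ≤ ker l(B) × ker l(C)` (families), NO hypothesis**: every `g' ∈ ker l(B × C)(ℂ)` is `⋀•(u ⊕ v)` with `⋀•u ∈ ker l(B)(ℂ)`,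
`⋀•v ∈ ker l(C)(ℂ)` — `g'₁ ∈ C(B × C) ⊗ ℂ ⊂ C(B) × C(C)` is block diagonal (`prodBlockDiag_eq_of_mem_centralizerGroup`) and each block
transfers along `B ⇄ B × C`, `C ⇄ B × C`. The summit tree proves the same statement, by a generic stabiliser argument, as
`Summit.HodgeConjecture.HodgeConjecture.Ring2.Hypotheses.exists_eq_prodBlockDiagEquiv_of_mem_specialLefschetzGroup_prod`
(`Summits/…/Ring2HypothesesDescentAbsoluteExteriorStabilizerProducts`, not importable into `Literature/`); restated Literature-side here.
[cite: Milne1999LefschetzClasses, §1 p. 643 (C(A) ⊂ C(A₁) × ⋯ × C(A_s)) and Prop. 1.5] -/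
theorem exists_eq_prodBlockDiagEquiv_of_mem_specialLefschetzGroup_prod
    {g' : ∀ k : ℕ, complexBetti (B.prod C).X k ≃ₗ[ℂ] complexBetti (B.prod C).X k}
    (hg' : g' ∈ specialLefschetzGroup (B.prod C).dim (B.prod C).X) :
    ∃ (u : complexBetti B.X 1 ≃ₗ[ℂ] complexBetti B.X 1) (v : complexBetti C.X 1 ≃ₗ[ℂ] complexBetti C.X 1),
      (fun k ↦ exteriorPullbackEquiv (AbelianVariety.hasExteriorCohomologyH1_complexPoints B) u k) ∈ specialLefschetzGroup B.dim B.X ∧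
        (fun k ↦ exteriorPullbackEquiv (AbelianVariety.hasExteriorCohomologyH1_complexPoints C) v k) ∈ specialLefschetzGroup C.dim C.X ∧
        g' = fun k ↦ exteriorPullbackEquiv (AbelianVariety.hasExteriorCohomologyH1_complexPoints (B.prod C)) (prodBlockDiagEquiv u v) k := by
  have h1 : g' 1 ∈ centralizerGroup (B.prod C) := specialLefschetzGroup_map_one_le_centralizerGroup _ ⟨g', hg', rfl⟩
  set u := centralizerGroup.restrictFstHom B C ⟨g' 1, h1⟩ with hu
  set v := centralizerGroup.restrictSndHom B C ⟨g' 1, h1⟩ with hv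
  have hkey : prodBlockDiagEquiv u v = g' 1 := by
    refine LinearEquiv.toLinearMap_injective ?_
    rw [coe_prodBlockDiagEquiv, hu, hv, centralizerGroup.coe_restrictFstHom, centralizerGroup.coe_restrictSndHom]
    exact prodBlockDiag_eq_of_mem_centralizerGroup h1
  have hg'eq : g' = fun k ↦ exteriorPullbackEquiv (AbelianVariety.hasExteriorCohomologyH1_complexPoints (B.prod C))
      (prodBlockDiagEquiv u v) k := by
    rw [hkey]; exact specialLefschetzGroup_eq_exteriorPullbackEquiv hg'
  have hP : (fun k ↦ exteriorPullbackEquiv (AbelianVariety.hasExteriorCohomologyH1_complexPoints (B.prod C))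
      (prodBlockDiagEquiv u v) k) ∈ specialLefschetzGroup (B.prod C).dim (B.prod C).X := hg'eq ▸ hg'
  exact ⟨u, v,
    exteriorPullbackEquiv_mem_specialLefschetzGroup_of_retraction (AbelianVariety.prodLift (𝟙 B) (0 : B ⟶ C)) (AbelianVariety.fst B C)
      (AbelianVariety.prodLift_fst _ _) (fun y ↦ prodBlockDiagEquiv_apply_map_fst u v y) hP,
    exteriorPullbackEquiv_mem_specialLefschetzGroup_of_retraction (AbelianVariety.prodLift (0 : C ⟶ B) (𝟙 C)) (AbelianVariety.snd B C)
      (AbelianVariety.prodLift_snd _ _) (fun y ↦ prodBlockDiagEquiv_apply_map_snd u v y) hP, hg'eq⟩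

/-- **`L(B × C) ≤ L(B) × L(C)` (families), NO hypothesis**: every `g' ∈ L(B × C)(ℂ)` is `⋀•(u ⊕ v)` with `⋀•u ∈ L(B)(ℂ)`, `⋀•v ∈ L(C)(ℂ)`
(the tree's `exists_eq_prodBlockDiagEquiv_of_mem_map_lefschetzGroup_one_prod` needs `dim B, dim C ≥ 1`).
[cite: Milne1999LefschetzClasses, §1 p. 643 (C(A) ⊂ C(A₁) × ⋯ × C(A_s)), Def. 4.3 and Cor. 4.7] -/
theorem exists_eq_prodBlockDiagEquiv_of_mem_lefschetzGroup_prod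
    {g' : ∀ k : ℕ, complexBetti (B.prod C).X k ≃ₗ[ℂ] complexBetti (B.prod C).X k}
    (hg' : g' ∈ lefschetzGroup (B.prod C).dim (B.prod C).X) :
    ∃ (u : complexBetti B.X 1 ≃ₗ[ℂ] complexBetti B.X 1) (v : complexBetti C.X 1 ≃ₗ[ℂ] complexBetti C.X 1),
      (fun k ↦ exteriorPullbackEquiv (AbelianVariety.hasExteriorCohomologyH1_complexPoints B) u k) ∈ lefschetzGroup B.dim B.X ∧
        (fun k ↦ exteriorPullbackEquiv (AbelianVariety.hasExteriorCohomologyH1_complexPoints C) v k) ∈ lefschetzGroup C.dim C.X ∧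
        g' = fun k ↦ exteriorPullbackEquiv (AbelianVariety.hasExteriorCohomologyH1_complexPoints (B.prod C)) (prodBlockDiagEquiv u v) k := by
  have h1 : g' 1 ∈ centralizerGroup (B.prod C) := apply_one_mem_centralizerGroup_of_mem_lefschetzGroup hg'
  set u := centralizerGroup.restrictFstHom B C ⟨g' 1, h1⟩ with hu
  set v := centralizerGroup.restrictSndHom B C ⟨g' 1, h1⟩ with hv
  have hkey : prodBlockDiagEquiv u v = g' 1 := by
    refine LinearEquiv.toLinearMap_injective ?_
    rw [coe_prodBlockDiagEquiv, hu, hv, centralizerGroup.coe_restrictFstHom, centralizerGroup.coe_restrictSndHom]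
    exact prodBlockDiag_eq_of_mem_centralizerGroup h1
  have hg'eq : g' = fun k ↦ exteriorPullbackEquiv (AbelianVariety.hasExteriorCohomologyH1_complexPoints (B.prod C))
      (prodBlockDiagEquiv u v) k := by
    rw [hkey]; exact lefschetzGroup_eq_exteriorPullbackEquiv hg'
  have hP : (fun k ↦ exteriorPullbackEquiv (AbelianVariety.hasExteriorCohomologyH1_complexPoints (B.prod C))
      (prodBlockDiagEquiv u v) k) ∈ lefschetzGroup (B.prod C).dim (B.prod C).X := hg'eq ▸ hg'
  exact ⟨u, v,
    exteriorPullbackEquiv_mem_lefschetzGroup_of_retraction (AbelianVariety.prodLift (𝟙 B) (0 : B ⟶ C)) (AbelianVariety.fst B C)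
      (AbelianVariety.prodLift_fst _ _) (fun y ↦ prodBlockDiagEquiv_apply_map_fst u v y) hP,
    exteriorPullbackEquiv_mem_lefschetzGroup_of_retraction (AbelianVariety.prodLift (0 : C ⟶ B) (𝟙 C)) (AbelianVariety.snd B C)
      (AbelianVariety.prodLift_snd _ _) (fun y ↦ prodBlockDiagEquiv_apply_map_snd u v y) hP, hg'eq⟩

variable (m n : ℕ)

/-- **`⊇` for `ker l`: if `⋀•(u ⊕ v) ∈ ker l(B × C)(ℂ)` then `⋀•(u^{⊕(m+1)} ⊕ v^{⊕(n+1)}) ∈ ker l(B^{m+1} × C^{n+1})(ℂ)`.** With `N = m + n + 1`: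
`⋀•((u ⊕ v)^{⊕(N+1)}) ∈ ker l((B × C)^{N+1})` (§3); the shuffle `σ : (B × C)^{N+1} ≅ B^{N+1} × C^{N+1}` intertwines it with
`⋀•(u^{⊕(N+1)} ⊕ v^{⊕(N+1)})` (the lane's `exists_shuffle_powSucc_prod`), and the product of the retractions `B^{N+1} → B^{m+1}`, `C^{N+1} → C^{n+1}`
(they intertwine the diagonals because `u ∈ C(B) ⊗ ℂ`, `v ∈ C(C) ⊗ ℂ`, Milne §1) carries it to `B^{m+1} × C^{n+1}` (§2).
[cite: Milne1999LefschetzClasses, §1 p. 643 and Prop. 1.5] [cite: MoonenZarhin1999LowDim, §1] -/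
theorem prodBlockDiagEquiv_diagPow_mem_specialLefschetzGroup_of_mem {u : complexBetti B.X 1 ≃ₗ[ℂ] complexBetti B.X 1}
    {v : complexBetti C.X 1 ≃ₗ[ℂ] complexBetti C.X 1}
    (h : (fun k ↦ exteriorPullbackEquiv (AbelianVariety.hasExteriorCohomologyH1_complexPoints (B.prod C)) (prodBlockDiagEquiv u v) k) ∈
      specialLefschetzGroup (B.prod C).dim (B.prod C).X) :
    (fun k ↦ exteriorPullbackEquiv (AbelianVariety.hasExteriorCohomologyH1_complexPoints ((B.powSucc m).prod (C.powSucc n)))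
        (prodBlockDiagEquiv (diagPow B u m) (diagPow C v n)) k) ∈
      specialLefschetzGroup ((B.powSucc m).prod (C.powSucc n)).dim ((B.powSucc m).prod (C.powSucc n)).X := by
  have hBC : prodBlockDiagEquiv u v ∈ centralizerGroup (B.prod C) :=
    specialLefschetzGroup_map_one_le_centralizerGroup _ ⟨_, h, exteriorPullbackEquiv_one_eq _ _⟩
  have huC : u ∈ centralizerGroup B := (prodBlockDiagEquiv_mem_centralizerGroup_iff.1 hBC).1
  have hvC : v ∈ centralizerGroup C := (prodBlockDiagEquiv_mem_centralizerGroup_iff.1 hBC).2.1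
  -- up to `(B × C)^{N+1}`, `N = m + n + 1`
  have hN := diagPowExterior_mem_specialLefschetzGroup_powSucc (B.prod C) (m + n + 1) h
  -- the retraction `(B × C)^{N+1} → B^{N+1} × C^{N+1} → B^{m+1} × C^{n+1}` and its section
  obtain ⟨σ, τ, -, hτσ, hint⟩ := exists_shuffle_powSucc_prod B C (m + n + 1)
  obtain ⟨ιB, πB, hB⟩ := exists_retraction_powSucc_left B m n
  obtain ⟨ιC, πC, hC⟩ := exists_retraction_powSucc_right C m n
  refine exteriorPullbackEquiv_mem_specialLefschetzGroup_of_retraction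
    (AbelianVariety.prodLift (AbelianVariety.fst _ _ ≫ ιB) (AbelianVariety.snd _ _ ≫ ιC) ≫ τ)
    (σ ≫ AbelianVariety.prodLift (AbelianVariety.fst _ _ ≫ πB) (AbelianVariety.snd _ _ ≫ πC))
    (retraction_comp (retraction_prod hB hC) hτσ) (fun y ↦ ?_) hN
  rw [complexBetti_map_comp_apply, complexBetti_map_comp_apply, hint u v,
    intertwine_prod πB πC (diagPow B u (m + n + 1)) (diagPow B u m) (diagPow C v (m + n + 1)) (diagPow C v n)
      (fun q ↦ diagPow_map_powSucc huC _ _ πB q) (fun z ↦ diagPow_map_powSucc hvC _ _ πC z) y]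

/-- **`⊇` for `L`: if `⋀•(u ⊕ v) ∈ L(B × C)(ℂ)` then `⋀•(u^{⊕(m+1)} ⊕ v^{⊕(n+1)}) ∈ L(B^{m+1} × C^{n+1})(ℂ)`.**
[cite: Milne1999LefschetzClasses, §1 p. 643, Def. 4.3 and Cor. 4.7] [cite: MoonenZarhin1999LowDim, §1] -/
theorem prodBlockDiagEquiv_diagPow_mem_lefschetzGroup_of_mem {u : complexBetti B.X 1 ≃ₗ[ℂ] complexBetti B.X 1}
    {v : complexBetti C.X 1 ≃ₗ[ℂ] complexBetti C.X 1}
    (h : (fun k ↦ exteriorPullbackEquiv (AbelianVariety.hasExteriorCohomologyH1_complexPoints (B.prod C)) (prodBlockDiagEquiv u v) k) ∈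
      lefschetzGroup (B.prod C).dim (B.prod C).X) :
    (fun k ↦ exteriorPullbackEquiv (AbelianVariety.hasExteriorCohomologyH1_complexPoints ((B.powSucc m).prod (C.powSucc n)))
        (prodBlockDiagEquiv (diagPow B u m) (diagPow C v n)) k) ∈
      lefschetzGroup ((B.powSucc m).prod (C.powSucc n)).dim ((B.powSucc m).prod (C.powSucc n)).X := by
  have hBC : prodBlockDiagEquiv u v ∈ centralizerGroup (B.prod C) := by
    have e := apply_one_mem_centralizerGroup_of_mem_lefschetzGroup h
    rwa [exteriorPullbackEquiv_one_eq] at e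
  have huC : u ∈ centralizerGroup B := (prodBlockDiagEquiv_mem_centralizerGroup_iff.1 hBC).1
  have hvC : v ∈ centralizerGroup C := (prodBlockDiagEquiv_mem_centralizerGroup_iff.1 hBC).2.1
  have hN := diagPowExterior_mem_lefschetzGroup_powSucc (B.prod C) (m + n + 1) h
  obtain ⟨σ, τ, -, hτσ, hint⟩ := exists_shuffle_powSucc_prod B C (m + n + 1)
  obtain ⟨ιB, πB, hB⟩ := exists_retraction_powSucc_left B m n
  obtain ⟨ιC, πC, hC⟩ := exists_retraction_powSucc_right C m n
  refine exteriorPullbackEquiv_mem_lefschetzGroup_of_retraction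
    (AbelianVariety.prodLift (AbelianVariety.fst _ _ ≫ ιB) (AbelianVariety.snd _ _ ≫ ιC) ≫ τ)
    (σ ≫ AbelianVariety.prodLift (AbelianVariety.fst _ _ ≫ πB) (AbelianVariety.snd _ _ ≫ πC))
    (retraction_comp (retraction_prod hB hC) hτσ) (fun y ↦ ?_) hN
  rw [complexBetti_map_comp_apply, complexBetti_map_comp_apply, hint u v,
    intertwine_prod πB πC (diagPow B u (m + n + 1)) (diagPow B u m) (diagPow C v (m + n + 1)) (diagPow C v n)
      (fun q ↦ diagPow_map_powSucc huC _ _ πB q) (fun z ↦ diagPow_map_powSucc hvC _ _ πC z) y]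

/-- **`⊆` for `ker l`: every element of `ker l(B^{m+1} × C^{n+1})(ℂ)` is `⋀•(u^{⊕(m+1)} ⊕ v^{⊕(n+1)})` with `⋀•(u ⊕ v) ∈ ker l(B × C)(ℂ)`**
— `g'₁ ∈ C(B^{m+1} × C^{n+1}) ⊂ C(B^{m+1}) × C(C^{n+1}) = C(B)^{diag} × C(C)^{diag}` (Milne §1), and `⋀•(u ⊕ v) ∈ ker l(B × C)` by transfer
along the retraction `B^{m+1} × C^{n+1} → B × C` (product of sections of the last factors, which intertwine `u^{⊕(m+1)} ⊕ v^{⊕(n+1)}` with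
`u ⊕ v`). [cite: Milne1999LefschetzClasses, §1 p. 643 and Prop. 1.5] [cite: MoonenZarhin1999LowDim, §1] -/
theorem exists_of_mem_specialLefschetzGroup_powSucc_prod_powSucc
    {g' : ∀ k : ℕ, complexBetti ((B.powSucc m).prod (C.powSucc n)).X k ≃ₗ[ℂ] complexBetti ((B.powSucc m).prod (C.powSucc n)).X k}
    (hg' : g' ∈ specialLefschetzGroup ((B.powSucc m).prod (C.powSucc n)).dim ((B.powSucc m).prod (C.powSucc n)).X) :
    ∃ (u : complexBetti B.X 1 ≃ₗ[ℂ] complexBetti B.X 1) (v : complexBetti C.X 1 ≃ₗ[ℂ] complexBetti C.X 1),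
      (fun k ↦ exteriorPullbackEquiv (AbelianVariety.hasExteriorCohomologyH1_complexPoints (B.prod C)) (prodBlockDiagEquiv u v) k) ∈
          specialLefschetzGroup (B.prod C).dim (B.prod C).X ∧
        g' = fun k ↦ exteriorPullbackEquiv (AbelianVariety.hasExteriorCohomologyH1_complexPoints ((B.powSucc m).prod (C.powSucc n)))
          (prodBlockDiagEquiv (diagPow B u m) (diagPow C v n)) k := by
  have h1 : g' 1 ∈ centralizerGroup ((B.powSucc m).prod (C.powSucc n)) :=
    specialLefschetzGroup_map_one_le_centralizerGroup _ ⟨g', hg', rfl⟩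
  set U := centralizerGroup.restrictFstHom (B.powSucc m) (C.powSucc n) ⟨g' 1, h1⟩ with hU
  set V := centralizerGroup.restrictSndHom (B.powSucc m) (C.powSucc n) ⟨g' 1, h1⟩ with hV
  have hkey : prodBlockDiagEquiv U V = g' 1 := by
    refine LinearEquiv.toLinearMap_injective ?_
    rw [coe_prodBlockDiagEquiv, hU, hV, centralizerGroup.coe_restrictFstHom, centralizerGroup.coe_restrictSndHom]
    exact prodBlockDiag_eq_of_mem_centralizerGroup h1
  have h1' : prodBlockDiagEquiv U V ∈ centralizerGroup ((B.powSucc m).prod (C.powSucc n)) := by rw [hkey]; exact h1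
  obtain ⟨hUc, hVc, -, -⟩ := prodBlockDiagEquiv_mem_centralizerGroup_iff.1 h1'
  obtain ⟨u, hu, huU⟩ := exists_eq_diagPow_of_mem_centralizerGroup m U hUc
  obtain ⟨v, hv, hvV⟩ := exists_eq_diagPow_of_mem_centralizerGroup n V hVc
  have hg'eq : g' = fun k ↦ exteriorPullbackEquiv
      (AbelianVariety.hasExteriorCohomologyH1_complexPoints ((B.powSucc m).prod (C.powSucc n)))
      (prodBlockDiagEquiv (diagPow B u m) (diagPow C v n)) k := by
    rw [huU, hvV, hkey]; exact specialLefschetzGroup_eq_exteriorPullbackEquiv hg'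
  refine ⟨u, v, ?_, hg'eq⟩
  -- transfer along `B × C ⊂ B^{m+1} × C^{n+1}` (sections of the powers, blockwise)
  obtain ⟨ιB, πB, hB⟩ := exists_section_powSucc B m
  obtain ⟨ιC, πC, hC⟩ := exists_section_powSucc C n
  exact exteriorPullbackEquiv_mem_specialLefschetzGroup_of_retraction
    (AbelianVariety.prodLift (AbelianVariety.fst _ _ ≫ ιB) (AbelianVariety.snd _ _ ≫ ιC))
    (AbelianVariety.prodLift (AbelianVariety.fst _ _ ≫ πB) (AbelianVariety.snd _ _ ≫ πC)) (retraction_prod hB hC)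
    (fun y ↦ intertwine_prod πB πC (diagPow B u m) u (diagPow C v n) v (fun q ↦ diagPow_intertwine_right hu πB q)
      (fun z ↦ diagPow_intertwine_right hv πC z) y) (hg'eq ▸ hg')

/-- **`⊆` for `L`: every element of `L(B^{m+1} × C^{n+1})(ℂ)` is `⋀•(u^{⊕(m+1)} ⊕ v^{⊕(n+1)})` with `⋀•(u ⊕ v) ∈ L(B × C)(ℂ)`.**
[cite: Milne1999LefschetzClasses, §1 p. 643, Def. 4.3 and Cor. 4.7] [cite: MoonenZarhin1999LowDim, §1] -/
theorem exists_of_mem_lefschetzGroup_powSucc_prod_powSucc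
    {g' : ∀ k : ℕ, complexBetti ((B.powSucc m).prod (C.powSucc n)).X k ≃ₗ[ℂ] complexBetti ((B.powSucc m).prod (C.powSucc n)).X k}
    (hg' : g' ∈ lefschetzGroup ((B.powSucc m).prod (C.powSucc n)).dim ((B.powSucc m).prod (C.powSucc n)).X) :
    ∃ (u : complexBetti B.X 1 ≃ₗ[ℂ] complexBetti B.X 1) (v : complexBetti C.X 1 ≃ₗ[ℂ] complexBetti C.X 1),
      (fun k ↦ exteriorPullbackEquiv (AbelianVariety.hasExteriorCohomologyH1_complexPoints (B.prod C)) (prodBlockDiagEquiv u v) k) ∈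
          lefschetzGroup (B.prod C).dim (B.prod C).X ∧
        g' = fun k ↦ exteriorPullbackEquiv (AbelianVariety.hasExteriorCohomologyH1_complexPoints ((B.powSucc m).prod (C.powSucc n)))
          (prodBlockDiagEquiv (diagPow B u m) (diagPow C v n)) k := by
  have h1 : g' 1 ∈ centralizerGroup ((B.powSucc m).prod (C.powSucc n)) := apply_one_mem_centralizerGroup_of_mem_lefschetzGroup hg'
  set U := centralizerGroup.restrictFstHom (B.powSucc m) (C.powSucc n) ⟨g' 1, h1⟩ with hU
  set V := centralizerGroup.restrictSndHom (B.powSucc m) (C.powSucc n) ⟨g' 1, h1⟩ with hV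
  have hkey : prodBlockDiagEquiv U V = g' 1 := by
    refine LinearEquiv.toLinearMap_injective ?_
    rw [coe_prodBlockDiagEquiv, hU, hV, centralizerGroup.coe_restrictFstHom, centralizerGroup.coe_restrictSndHom]
    exact prodBlockDiag_eq_of_mem_centralizerGroup h1
  have h1' : prodBlockDiagEquiv U V ∈ centralizerGroup ((B.powSucc m).prod (C.powSucc n)) := by rw [hkey]; exact h1
  obtain ⟨hUc, hVc, -, -⟩ := prodBlockDiagEquiv_mem_centralizerGroup_iff.1 h1'
  obtain ⟨u, hu, huU⟩ := exists_eq_diagPow_of_mem_centralizerGroup m U hUc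
  obtain ⟨v, hv, hvV⟩ := exists_eq_diagPow_of_mem_centralizerGroup n V hVc
  have hg'eq : g' = fun k ↦ exteriorPullbackEquiv
      (AbelianVariety.hasExteriorCohomologyH1_complexPoints ((B.powSucc m).prod (C.powSucc n)))
      (prodBlockDiagEquiv (diagPow B u m) (diagPow C v n)) k := by
    rw [huU, hvV, hkey]; exact lefschetzGroup_eq_exteriorPullbackEquiv hg'
  refine ⟨u, v, ?_, hg'eq⟩
  obtain ⟨ιB, πB, hB⟩ := exists_section_powSucc B m
  obtain ⟨ιC, πC, hC⟩ := exists_section_powSucc C n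
  exact exteriorPullbackEquiv_mem_lefschetzGroup_of_retraction
    (AbelianVariety.prodLift (AbelianVariety.fst _ _ ≫ ιB) (AbelianVariety.snd _ _ ≫ ιC))
    (AbelianVariety.prodLift (AbelianVariety.fst _ _ ≫ πB) (AbelianVariety.snd _ _ ≫ πC)) (retraction_prod hB hC)
    (fun y ↦ intertwine_prod πB πC (diagPow B u m) u (diagPow C v n) v (fun q ↦ diagPow_intertwine_right hu πB q)
      (fun z ↦ diagPow_intertwine_right hv πC z) y) (hg'eq ▸ hg')

/-- **`ker l(B^{m+1} × C^{n+1})(ℂ) = ker l(B × C)(ℂ)` ACTING BLOCK-DIAGONALLY, for ARBITRARY `B`, `C`** (Prop. 1.5 «`S(A_1) × ⋯ × S(A_s) → S(A)`»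
reduced to exponents `1`, no hypothesis on `Hom(B, C)`): `g' ∈ ker l(B^{m+1} × C^{n+1})` iff `g' = ⋀•(u^{⊕(m+1)} ⊕ v^{⊕(n+1)})` with
`⋀•(u ⊕ v) ∈ ker l(B × C)`. The summit tree proves the same statement, by a generic stabiliser argument, as
`Summit.HodgeConjecture.HodgeConjecture.Ring2.Hypotheses.mem_specialLefschetzGroup_powSucc_prod_powSucc_iff`
(`Summits/…/Ring2HypothesesDescentAbsoluteExteriorStabilizerProductsPowers`, not importable into `Literature/`); restated Literature-side
here, next to its `L`-version with the character. [cite: Milne1999LefschetzClasses, §1 p. 643 and Prop. 1.5 (p. 644)] [cite: MoonenZarhin1999LowDim, §1] -/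
theorem mem_specialLefschetzGroup_powSucc_prod_powSucc_iff
    (g' : ∀ k : ℕ, complexBetti ((B.powSucc m).prod (C.powSucc n)).X k ≃ₗ[ℂ] complexBetti ((B.powSucc m).prod (C.powSucc n)).X k) :
    g' ∈ specialLefschetzGroup ((B.powSucc m).prod (C.powSucc n)).dim ((B.powSucc m).prod (C.powSucc n)).X ↔
      ∃ (u : complexBetti B.X 1 ≃ₗ[ℂ] complexBetti B.X 1) (v : complexBetti C.X 1 ≃ₗ[ℂ] complexBetti C.X 1),
        (fun k ↦ exteriorPullbackEquiv (AbelianVariety.hasExteriorCohomologyH1_complexPoints (B.prod C)) (prodBlockDiagEquiv u v) k) ∈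
            specialLefschetzGroup (B.prod C).dim (B.prod C).X ∧
          g' = fun k ↦ exteriorPullbackEquiv (AbelianVariety.hasExteriorCohomologyH1_complexPoints ((B.powSucc m).prod (C.powSucc n)))
            (prodBlockDiagEquiv (diagPow B u m) (diagPow C v n)) k :=
  ⟨exists_of_mem_specialLefschetzGroup_powSucc_prod_powSucc B C m n,
    fun ⟨_, _, h, e⟩ ↦ e ▸ prodBlockDiagEquiv_diagPow_mem_specialLefschetzGroup_of_mem B C m n h⟩

/-- **`L(B^{m+1} × C^{n+1})(ℂ) = L(B × C)(ℂ)` ACTING BLOCK-DIAGONALLY, for ARBITRARY `B`, `C`** (Cor. 4.7 reduced to exponents `1`, no hypothesis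
on `Hom(B, C)`; Moonen–Zarhin §1 «we can identify `Hg(X_1^{n_1} × ⋯ × X_r^{n_r})` with `Hg(X_1 × ⋯ × X_r)`» for Milne's `L`, `r = 2`).
[cite: Milne1999LefschetzClasses, §1 p. 643, Def. 4.3 and Cor. 4.7 (p. 660)] [cite: MoonenZarhin1999LowDim, §1] -/
theorem mem_lefschetzGroup_powSucc_prod_powSucc_iff
    (g' : ∀ k : ℕ, complexBetti ((B.powSucc m).prod (C.powSucc n)).X k ≃ₗ[ℂ] complexBetti ((B.powSucc m).prod (C.powSucc n)).X k) :
    g' ∈ lefschetzGroup ((B.powSucc m).prod (C.powSucc n)).dim ((B.powSucc m).prod (C.powSucc n)).X ↔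
      ∃ (u : complexBetti B.X 1 ≃ₗ[ℂ] complexBetti B.X 1) (v : complexBetti C.X 1 ≃ₗ[ℂ] complexBetti C.X 1),
        (fun k ↦ exteriorPullbackEquiv (AbelianVariety.hasExteriorCohomologyH1_complexPoints (B.prod C)) (prodBlockDiagEquiv u v) k) ∈
            lefschetzGroup (B.prod C).dim (B.prod C).X ∧
          g' = fun k ↦ exteriorPullbackEquiv (AbelianVariety.hasExteriorCohomologyH1_complexPoints ((B.powSucc m).prod (C.powSucc n)))
            (prodBlockDiagEquiv (diagPow B u m) (diagPow C v n)) k :=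
  ⟨exists_of_mem_lefschetzGroup_powSucc_prod_powSucc B C m n,
    fun ⟨_, _, h, e⟩ ↦ e ▸ prodBlockDiagEquiv_diagPow_mem_lefschetzGroup_of_mem B C m n h⟩

/-- **On `H¹`, for `ker l`**: `u^{⊕(m+1)} ⊕ v^{⊕(n+1)} ∈ ker l(B^{m+1} × C^{n+1})(ℂ)|_{H¹}` iff `u ⊕ v ∈ ker l(B × C)(ℂ)|_{H¹}` (the blocks of
a block sum and `u` in `u^{⊕(m+1)}` are unique). [cite: Milne1999LefschetzClasses, §1 p. 643 and Prop. 1.5] -/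
theorem prodBlockDiagEquiv_diagPow_mem_map_specialLefschetzGroup_one_iff (u : complexBetti B.X 1 ≃ₗ[ℂ] complexBetti B.X 1)
    (v : complexBetti C.X 1 ≃ₗ[ℂ] complexBetti C.X 1) :
    prodBlockDiagEquiv (diagPow B u m) (diagPow C v n) ∈
        (specialLefschetzGroup ((B.powSucc m).prod (C.powSucc n)).dim ((B.powSucc m).prod (C.powSucc n)).X).map
          (Pi.evalMonoidHom (fun k : ℕ ↦ complexBetti ((B.powSucc m).prod (C.powSucc n)).X k ≃ₗ[ℂ]
            complexBetti ((B.powSucc m).prod (C.powSucc n)).X k) 1) ↔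
      prodBlockDiagEquiv u v ∈ (specialLefschetzGroup (B.prod C).dim (B.prod C).X).map
        (Pi.evalMonoidHom (fun k : ℕ ↦ complexBetti (B.prod C).X k ≃ₗ[ℂ] complexBetti (B.prod C).X k) 1) := by
  rw [← exteriorPullbackEquiv_mem_specialLefschetzGroup_iff_mem_map, ← exteriorPullbackEquiv_mem_specialLefschetzGroup_iff_mem_map]
  refine ⟨fun h ↦ ?_, prodBlockDiagEquiv_diagPow_mem_specialLefschetzGroup_of_mem B C m n⟩
  obtain ⟨u', v', h', e⟩ := exists_of_mem_specialLefschetzGroup_powSucc_prod_powSucc B C m n h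
  have e1 : prodBlockDiagEquiv (diagPow B u m) (diagPow C v n) = prodBlockDiagEquiv (diagPow B u' m) (diagPow C v' n) := by
    simpa only [exteriorPullbackEquiv_one_eq] using congrFun e 1
  obtain ⟨eu, ev⟩ := prodBlockDiagEquiv_inj e1
  rw [diagPow_injective m eu, diagPow_injective n ev]
  exact h'

/-- **On `H¹`, for `L`**: `u^{⊕(m+1)} ⊕ v^{⊕(n+1)} ∈ L(B^{m+1} × C^{n+1})(ℂ)|_{H¹}` iff `u ⊕ v ∈ L(B × C)(ℂ)|_{H¹}`.
[cite: Milne1999LefschetzClasses, §1 p. 643, Def. 4.3 and Cor. 4.7] -/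
theorem prodBlockDiagEquiv_diagPow_mem_map_lefschetzGroup_one_iff (u : complexBetti B.X 1 ≃ₗ[ℂ] complexBetti B.X 1)
    (v : complexBetti C.X 1 ≃ₗ[ℂ] complexBetti C.X 1) :
    prodBlockDiagEquiv (diagPow B u m) (diagPow C v n) ∈
        (lefschetzGroup ((B.powSucc m).prod (C.powSucc n)).dim ((B.powSucc m).prod (C.powSucc n)).X).map
          (Pi.evalMonoidHom (fun k : ℕ ↦ complexBetti ((B.powSucc m).prod (C.powSucc n)).X k ≃ₗ[ℂ]
            complexBetti ((B.powSucc m).prod (C.powSucc n)).X k) 1) ↔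
      prodBlockDiagEquiv u v ∈ (lefschetzGroup (B.prod C).dim (B.prod C).X).map
        (Pi.evalMonoidHom (fun k : ℕ ↦ complexBetti (B.prod C).X k ≃ₗ[ℂ] complexBetti (B.prod C).X k) 1) := by
  rw [← exteriorPullbackEquiv_mem_lefschetzGroup_iff_mem_map, ← exteriorPullbackEquiv_mem_lefschetzGroup_iff_mem_map]
  refine ⟨fun h ↦ ?_, prodBlockDiagEquiv_diagPow_mem_lefschetzGroup_of_mem B C m n⟩
  obtain ⟨u', v', h', e⟩ := exists_of_mem_lefschetzGroup_powSucc_prod_powSucc B C m n h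
  have e1 : prodBlockDiagEquiv (diagPow B u m) (diagPow C v n) = prodBlockDiagEquiv (diagPow B u' m) (diagPow C v' n) := by
    simpa only [exteriorPullbackEquiv_one_eq] using congrFun e 1
  obtain ⟨eu, ev⟩ := prodBlockDiagEquiv_inj e1
  rw [diagPow_injective m eu, diagPow_injective n ev]
  exact h'

end Products

/-! ### §5 `(L(B × C), l) ≅ (L(B^{m+1} × C^{n+1}), l)`: the group isomorphism, with `ker l ↔ ker l` and `w ↦ w` -/

section MulEquiv

variable (B C : AbelianVariety ℂ) (m n : ℕ)

/-- **`(L(B × C), l) ≅ (L(B^{m+1} × C^{n+1}), l)` EXPLICITLY, for ARBITRARY `B`, `C`**: a group isomorphism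
`e : L(B × C)(ℂ) ≃* L(B^{m+1} × C^{n+1})(ℂ)` with `(e g)₁ = u^{⊕(m+1)} ⊕ v^{⊕(n+1)}` whenever `g₁ = u ⊕ v` (every `g₁`, `g ∈ L(B × C)`, is such a
block sum), `e g ∈ ker l ⟺ g ∈ ker l`, and `e(w(c)) = w(c)` — so `e` matches the characters (`L = w(𝔾_m) · ker l`, `l ∘ w = 2`). Cor. 4.7's
«because two of the vertical maps are isomorphisms, so also is the third», with exponents reduced to `1` and no hypothesis on `Hom(B, C)`.
[cite: Milne1999LefschetzClasses, §1 p. 643, Prop. 1.5, Cor. 4.7 (p. 660) and p. 659 (l, w)] [cite: MoonenZarhin1999LowDim, §1] -/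
theorem exists_lefschetzGroup_prod_mulEquiv_powSucc_prod_powSucc :
    ∃ e : lefschetzGroup (B.prod C).dim (B.prod C).X ≃*
        lefschetzGroup ((B.powSucc m).prod (C.powSucc n)).dim ((B.powSucc m).prod (C.powSucc n)).X,
      (∀ (g : lefschetzGroup (B.prod C).dim (B.prod C).X) (u : complexBetti B.X 1 ≃ₗ[ℂ] complexBetti B.X 1)
          (v : complexBetti C.X 1 ≃ₗ[ℂ] complexBetti C.X 1), g.1 1 = prodBlockDiagEquiv u v →
          (e g).1 1 = prodBlockDiagEquiv (diagPow B u m) (diagPow C v n)) ∧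
      (∀ g : lefschetzGroup (B.prod C).dim (B.prod C).X,
        (e g).1 ∈ specialLefschetzGroup ((B.powSucc m).prod (C.powSucc n)).dim ((B.powSucc m).prod (C.powSucc n)).X ↔
          g.1 ∈ specialLefschetzGroup (B.prod C).dim (B.prod C).X) ∧
      ∀ c : ℂˣ, e ⟨weightCocharacter (B.prod C).X c, weightCocharacter_mem_lefschetzGroup c⟩ =
        ⟨weightCocharacter ((B.powSucc m).prod (C.powSucc n)).X c, weightCocharacter_mem_lefschetzGroup c⟩ := by
  -- `g ↦ g₁ ∈ C(B × C) ⊗ ℂ`, and the block map `w ↦ (w|_B)^{⊕(m+1)} ⊕ (w|_C)^{⊕(n+1)}` on `H¹`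
  let r : lefschetzGroup (B.prod C).dim (B.prod C).X →* centralizerGroup (B.prod C) :=
    { toFun := fun g ↦ ⟨g.1 1, apply_one_mem_centralizerGroup_of_mem_lefschetzGroup g.2⟩
      map_one' := rfl
      map_mul' := fun _ _ ↦ rfl }
  have hr : ∀ g : lefschetzGroup (B.prod C).dim (B.prod C).X, ((r g : centralizerGroup (B.prod C)) :
      complexBetti (B.prod C).X 1 ≃ₗ[ℂ] complexBetti (B.prod C).X 1) = g.1 1 := fun _ ↦ rfl
  let W : centralizerGroup (B.prod C) →*
      (complexBetti ((B.powSucc m).prod (C.powSucc n)).X 1 ≃ₗ[ℂ] complexBetti ((B.powSucc m).prod (C.powSucc n)).X 1) :=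
    { toFun := fun w ↦ prodBlockDiagEquiv (diagPow B (centralizerGroup.restrictFstHom B C w) m)
        (diagPow C (centralizerGroup.restrictSndHom B C w) n)
      map_one' := by simp only [map_one, diagPow_one, prodBlockDiagEquiv_one]
      map_mul' := fun w w' ↦ by simp only [map_mul, diagPow_mul, prodBlockDiagEquiv_mul] }
  have hW : ∀ w, W w = prodBlockDiagEquiv (diagPow B (centralizerGroup.restrictFstHom B C w) m)
      (diagPow C (centralizerGroup.restrictSndHom B C w) n) := fun _ ↦ rfl
  -- the blocks of `g₁` reassemble `g₁`
  have hkey : ∀ g : lefschetzGroup (B.prod C).dim (B.prod C).X,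
      prodBlockDiagEquiv (centralizerGroup.restrictFstHom B C (r g)) (centralizerGroup.restrictSndHom B C (r g)) = g.1 1 := fun g ↦ by
    refine LinearEquiv.toLinearMap_injective ?_
    rw [coe_prodBlockDiagEquiv, centralizerGroup.coe_restrictFstHom, centralizerGroup.coe_restrictSndHom, hr]
    exact prodBlockDiag_eq_of_mem_centralizerGroup (r g).2
  -- `⋀•(W g₁) ∈ L(B^{m+1} × C^{n+1})` (§4, `⊇`)
  have hmem : ∀ g : lefschetzGroup (B.prod C).dim (B.prod C).X,
      (fun k ↦ exteriorPullbackEquiv (AbelianVariety.hasExteriorCohomologyH1_complexPoints ((B.powSucc m).prod (C.powSucc n)))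
        (W (r g)) k) ∈ lefschetzGroup ((B.powSucc m).prod (C.powSucc n)).dim ((B.powSucc m).prod (C.powSucc n)).X := fun g ↦ by
    rw [hW]
    refine prodBlockDiagEquiv_diagPow_mem_lefschetzGroup_of_mem B C m n ?_
    rw [hkey g, ← lefschetzGroup_eq_exteriorPullbackEquiv g.2]
    exact g.2
  -- the homomorphism `F : L(B × C) → L(B^{m+1} × C^{n+1})`
  let EP := MulEquiv.ofBijective _ (bijective_evalOne_subgroupMap_lefschetzGroup' ((B.powSucc m).prod (C.powSucc n)))
  let F₁ : lefschetzGroup (B.prod C).dim (B.prod C).X →*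
      (lefschetzGroup ((B.powSucc m).prod (C.powSucc n)).dim ((B.powSucc m).prod (C.powSucc n)).X).map
        (Pi.evalMonoidHom (fun k : ℕ ↦ complexBetti ((B.powSucc m).prod (C.powSucc n)).X k ≃ₗ[ℂ]
          complexBetti ((B.powSucc m).prod (C.powSucc n)).X k) 1) :=
    (W.comp r).codRestrict _ fun g ↦ ⟨_, hmem g, exteriorPullbackEquiv_one_eq _ _⟩
  let F := EP.symm.toMonoidHom.comp F₁
  have hF1 : ∀ g, (F g).1 1 = W (r g) := fun g ↦ congrArg Subtype.val (EP.apply_symm_apply (F₁ g))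
  -- `F` is bijective
  have hinj : Function.Injective F := by
    intro g g' e
    have e1 : W (r g) = W (r g') := by rw [← hF1, ← hF1, e]
    rw [hW, hW] at e1
    obtain ⟨eu, ev⟩ := prodBlockDiagEquiv_inj e1
    have eu' := diagPow_injective m eu
    have ev' := diagPow_injective n ev
    refine Subtype.ext (lefschetzGroup_ext_one' g.2 g'.2 ?_)
    rw [← hkey g, ← hkey g', eu', ev']
  have hsurj : Function.Surjective F := by
    intro g'
    obtain ⟨u, v, huv, hg'eq⟩ := exists_of_mem_lefschetzGroup_powSucc_prod_powSucc B C m n g'.2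
    have hC : prodBlockDiagEquiv u v ∈ centralizerGroup (B.prod C) := by
      have e := apply_one_mem_centralizerGroup_of_mem_lefschetzGroup huv
      rwa [exteriorPullbackEquiv_one_eq] at e
    have hrg : r ⟨_, huv⟩ = ⟨prodBlockDiagEquiv u v, hC⟩ := Subtype.ext (exteriorPullbackEquiv_one_eq _ _)
    refine ⟨⟨_, huv⟩, Subtype.ext (lefschetzGroup_ext_one' (F _).2 g'.2 ?_)⟩
    rw [hF1, hrg, hW, centralizerGroup.restrictFstHom_prodBlockDiagEquiv, centralizerGroup.restrictSndHom_prodBlockDiagEquiv, hg'eq]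
    exact (exteriorPullbackEquiv_one_eq _ _).symm
  let e := MulEquiv.ofBijective F ⟨hinj, hsurj⟩
  have he : ∀ g, e g = F g := fun _ ↦ rfl
  refine ⟨e, fun g u v huv ↦ ?_, fun g ↦ ?_, fun c ↦ ?_⟩
  · -- `(e g)₁ = u^{⊕(m+1)} ⊕ v^{⊕(n+1)}`
    have hC : prodBlockDiagEquiv u v ∈ centralizerGroup (B.prod C) := huv ▸ (show g.1 1 ∈ centralizerGroup (B.prod C) from (r g).2)
    have hrg : r g = ⟨prodBlockDiagEquiv u v, hC⟩ := Subtype.ext huv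
    rw [he, hF1, hrg, hW, centralizerGroup.restrictFstHom_prodBlockDiagEquiv, centralizerGroup.restrictSndHom_prodBlockDiagEquiv]
  · -- `e g ∈ ker l ⟺ g ∈ ker l`
    rw [mem_specialLefschetzGroup_iff_apply_one_mem (e g).2, mem_specialLefschetzGroup_iff_apply_one_mem g.2, he, hF1, hW,
      ← hkey g]
    exact prodBlockDiagEquiv_diagPow_mem_map_specialLefschetzGroup_one_iff B C m n _ _
  · -- `e(w(c)) = w(c)`
    refine Subtype.ext (lefschetzGroup_ext_one' (e _).2 (weightCocharacter_mem_lefschetzGroup c) ?_)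
    have hC : prodBlockDiagEquiv (LinearEquiv.smulOfUnit c : complexBetti B.X 1 ≃ₗ[ℂ] complexBetti B.X 1)
        (LinearEquiv.smulOfUnit c : complexBetti C.X 1 ≃ₗ[ℂ] complexBetti C.X 1) ∈ centralizerGroup (B.prod C) := by
      rw [prodBlockDiagEquiv_smulOfUnit, ← weightCocharacter_one_eq_smulOfUnit (B.prod C)]
      exact (r ⟨weightCocharacter (B.prod C).X c, weightCocharacter_mem_lefschetzGroup c⟩).2
    have hrg : r ⟨weightCocharacter (B.prod C).X c, weightCocharacter_mem_lefschetzGroup c⟩ =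
        ⟨prodBlockDiagEquiv (LinearEquiv.smulOfUnit c) (LinearEquiv.smulOfUnit c), hC⟩ := by
      refine Subtype.ext ?_
      show weightCocharacter (B.prod C).X c 1 = prodBlockDiagEquiv (LinearEquiv.smulOfUnit c) (LinearEquiv.smulOfUnit c)
      rw [prodBlockDiagEquiv_smulOfUnit]
      exact weightCocharacter_one_eq_smulOfUnit (B.prod C) c
    rw [he, hF1, hrg, hW, centralizerGroup.restrictFstHom_prodBlockDiagEquiv, centralizerGroup.restrictSndHom_prodBlockDiagEquiv,
      diagPow_smulOfUnit, diagPow_smulOfUnit, prodBlockDiagEquiv_smulOfUnit]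
    exact (weightCocharacter_one_eq_smulOfUnit _ c).symm

/-- **`ker l(B × C)(ℂ) ≅ ker l(B^{m+1} × C^{n+1})(ℂ)` EXPLICITLY** (Prop. 1.5 «`S(A_1) × ⋯ × S(A_s) → S(A)`» with exponents reduced to `1`, no
hypothesis on `Hom(B, C)`): `s ↦` the element acting by `u^{⊕(m+1)} ⊕ v^{⊕(n+1)}` on `H¹` when `s₁ = u ⊕ v`.
[cite: Milne1999LefschetzClasses, §1 p. 643 and Prop. 1.5 (p. 644)] [cite: MoonenZarhin1999LowDim, §1] -/
theorem exists_specialLefschetzGroup_prod_mulEquiv_powSucc_prod_powSucc :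
    ∃ e : specialLefschetzGroup (B.prod C).dim (B.prod C).X ≃*
        specialLefschetzGroup ((B.powSucc m).prod (C.powSucc n)).dim ((B.powSucc m).prod (C.powSucc n)).X,
      ∀ (s : specialLefschetzGroup (B.prod C).dim (B.prod C).X) (u : complexBetti B.X 1 ≃ₗ[ℂ] complexBetti B.X 1)
        (v : complexBetti C.X 1 ≃ₗ[ℂ] complexBetti C.X 1), s.1 1 = prodBlockDiagEquiv u v →
        (e s).1 1 = prodBlockDiagEquiv (diagPow B u m) (diagPow C v n) := by
  obtain ⟨e, he1, he2, -⟩ := exists_lefschetzGroup_prod_mulEquiv_powSucc_prod_powSucc B C m n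
  let ι₁ : specialLefschetzGroup (B.prod C).dim (B.prod C).X →* lefschetzGroup (B.prod C).dim (B.prod C).X :=
    Subgroup.inclusion specialLefschetzGroup_le_lefschetzGroup
  let F : specialLefschetzGroup (B.prod C).dim (B.prod C).X →*
      specialLefschetzGroup ((B.powSucc m).prod (C.powSucc n)).dim ((B.powSucc m).prod (C.powSucc n)).X :=
    ((lefschetzGroup ((B.powSucc m).prod (C.powSucc n)).dim ((B.powSucc m).prod (C.powSucc n)).X).subtype.comp
      (e.toMonoidHom.comp ι₁)).codRestrict _ fun s ↦ (he2 _).2 s.2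
  have hF : ∀ s, (F s).1 = (e (ι₁ s)).1 := fun _ ↦ rfl
  refine ⟨MulEquiv.ofBijective F ⟨fun s t h ↦ ?_, fun t ↦ ?_⟩, fun s u v huv ↦ ?_⟩
  · have h1 : (e (ι₁ s)).1 = (e (ι₁ t)).1 := by rw [← hF, ← hF, h]
    exact Subgroup.inclusion_injective _ (e.injective (Subtype.ext h1))
  · set g := e.symm ⟨t.1, specialLefschetzGroup_le_lefschetzGroup t.2⟩ with hg
    have hgS : g.1 ∈ specialLefschetzGroup (B.prod C).dim (B.prod C).X := (he2 g).1 (by rw [hg, MulEquiv.apply_symm_apply]; exact t.2)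
    refine ⟨⟨g.1, hgS⟩, Subtype.ext ?_⟩
    rw [hF]
    have e1 : ι₁ ⟨g.1, hgS⟩ = g := Subtype.ext rfl
    rw [e1, hg, MulEquiv.apply_symm_apply]
  · show (F s).1 1 = _
    rw [hF]
    exact he1 _ u v huv

/-- **Torus coordinates with character pass from `B × C` to `B^{m+1} × C^{n+1}`** (the format of the lane's
`LefschetzGroupTorusFiniteProducts`: last coordinate the character, `= 1` on `ker l`, `= c²` at `w(c)`), for ARBITRARY `B`, `C`.
[cite: Milne1999LefschetzClasses, Cor. 4.7 (p. 660) and p. 659] -/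
theorem exists_lefschetzGroup_powSucc_prod_powSucc_mulEquiv_of_mulEquiv {T : Type*} [Group T]
    (eBC : lefschetzGroup (B.prod C).dim (B.prod C).X ≃* T × ℂˣ)
    (h1 : ∀ s : lefschetzGroup (B.prod C).dim (B.prod C).X, s.1 ∈ specialLefschetzGroup (B.prod C).dim (B.prod C).X → (eBC s).2 = 1)
    (h2 : ∀ c : ℂˣ, (eBC ⟨weightCocharacter (B.prod C).X c, weightCocharacter_mem_lefschetzGroup c⟩).2 = c ^ 2) :
    ∃ eP : lefschetzGroup ((B.powSucc m).prod (C.powSucc n)).dim ((B.powSucc m).prod (C.powSucc n)).X ≃* T × ℂˣ,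
      (∀ s : lefschetzGroup ((B.powSucc m).prod (C.powSucc n)).dim ((B.powSucc m).prod (C.powSucc n)).X,
        s.1 ∈ specialLefschetzGroup ((B.powSucc m).prod (C.powSucc n)).dim ((B.powSucc m).prod (C.powSucc n)).X → (eP s).2 = 1) ∧
      ∀ c : ℂˣ, (eP ⟨weightCocharacter ((B.powSucc m).prod (C.powSucc n)).X c, weightCocharacter_mem_lefschetzGroup c⟩).2 = c ^ 2 := by
  obtain ⟨e, -, hker, hw⟩ := exists_lefschetzGroup_prod_mulEquiv_powSucc_prod_powSucc B C m n
  refine ⟨e.symm.trans eBC, fun s hs ↦ ?_, fun c ↦ ?_⟩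
  · rw [MulEquiv.trans_apply]
    refine h1 _ ((hker (e.symm s)).1 ?_)
    rw [MulEquiv.apply_symm_apply]
    exact hs
  · rw [MulEquiv.trans_apply, ← hw c, MulEquiv.symm_apply_apply, h2]

/-- `L(B^{m+1} × C^{n+1})(ℂ) ≅ L(B × C)(ℂ)` as abstract groups, for arbitrary `B`, `C`. [cite: Milne1999LefschetzClasses, Cor. 4.7 (p. 660)]
[cite: MoonenZarhin1999LowDim, §1] -/
theorem nonempty_lefschetzGroup_powSucc_prod_powSucc_mulEquiv :
    Nonempty (lefschetzGroup ((B.powSucc m).prod (C.powSucc n)).dim ((B.powSucc m).prod (C.powSucc n)).X ≃*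
      lefschetzGroup (B.prod C).dim (B.prod C).X) := by
  obtain ⟨e, -⟩ := exists_lefschetzGroup_prod_mulEquiv_powSucc_prod_powSucc B C m n
  exact ⟨e.symm⟩

/-- `ker l(B^{m+1} × C^{n+1})(ℂ) ≅ ker l(B × C)(ℂ)` as abstract groups, for arbitrary `B`, `C`. [cite: Milne1999LefschetzClasses, Prop. 1.5 (p. 644)]
[cite: MoonenZarhin1999LowDim, §1] -/
theorem nonempty_specialLefschetzGroup_powSucc_prod_powSucc_mulEquiv :
    Nonempty (specialLefschetzGroup ((B.powSucc m).prod (C.powSucc n)).dim ((B.powSucc m).prod (C.powSucc n)).X ≃*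
      specialLefschetzGroup (B.prod C).dim (B.prod C).X) := by
  obtain ⟨e, -⟩ := exists_specialLefschetzGroup_prod_mulEquiv_powSucc_prod_powSucc B C m n
  exact ⟨e.symm⟩

end MulEquiv

end Literature.AlgebraicGeometry.Milne1999
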